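import Literature.MathematicalPhysics.QuantumFieldTheory.Balaban1983to89.B13FirstEstimate215

/-!
# `Balaban1983to89.B13Replacement223` — T. Bałaban, *Renormalization group approach to lattice gauge field
theories. II. Cluster expansions*, Commun. Math. Phys. **116** (1988) 1–22 [Balaban1988RG2Cluster], pp. 15–17:
THE PERTURBATIVE REPLACEMENT `σ(Z) → 0, (𝐔, 𝐉) → (U, 0)` under the integral of the «first estimate» (2.15),
ASSEMBLED — from the right side of (2.15) to the Gaussian integral (2.23) — in the finite-dimensional model of record

statement-level skeleton of published theorems with citation tags; proofs where landed; nothing here is a claim about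
the Yang–Mills mass gap

PDF held: `paper:balaban1988-cmp116-rg-ii-cluster` (journal page = PDF page + 0); quotations read as images from
`run/shared/lean/pub/pub-balaban/b2b-balaban-ref1/pages/1988-cmp116-rg-II-cluster/1988-cmp116-rg-II-cluster-p015-x2.png`,
`…-p016-x2.png`, `…-p017-x2.png`.

CITATION HEADER (verbatim).  p. 15 [PDF 15], after (2.15): *"In the expression on the right-hand side we replace the
operators by the corresponding operators with σ(Z) = 0, 𝐔 = U, 𝐉 = 0, and we estimate the error. For the quadratic
form in the first exponential the difference is a quadratic form ½⟨X, R₁X⟩, with matrix elements satisfying the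
bound"* p. 16 [PDF 16]: `|R₁(b, b′)| ≦ (O(1)e^{−1/3δ₀M} + O(α₀ + α₁)) exp(−½δ₀|b₋ − b′₋|)` (2.16). *"… The
determinants in the next factor are equal for the new operators, hence this factor can be estimated by
`exp((O(1)e^{−1/3δ₀M} + O(α₀ + α₁))|Z₀|)`. (2.17)  Similarly, the next Gaussian measure is replaced by the measure
with the new covariance, multiplied by a quotient of determinants, which can be estimated by (2.17), and by the
function exp ½⟨B, R₂B⟩ with R₂ satisfying (2.16). In the second exponential the difference between the new bilinear
form and the form in (2.15) is a bilinear from −⟨B, R₃X⟩ with R₃ satisfying (2.16). … The other quadratic forms,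
i.e. the forms R₁, R₂, R₃, can be bounded in a similar way using (2.16), by the forms
`½(O(1)e^{−(1/3)δ₀M} + O(α₀ + α₁))(‖ZX‖² + ‖Z₀B‖²)`. (2.21) Finally we estimate `χ_{k,Y₀}(B)χᶜ_{k,P}(B) ≦ exp(−½γ₂
(ε₁²/g_k²)|P| + ½γ₂‖PB‖²)`, (2.22) where γ₂ is a small, positive constant. Applying the above estimates to the"*
p. 17 [PDF 17]: *"expressions under the integral in (2.15), we obtain the following integral:
`∫dμ₀(X)|_Z exp(−½⟨Γ_k(Z₀,0)X, C^{(k)}(Z₀,0)Γ_k(Z₀,0)X⟩ + ½α₅‖ZX‖²)·∫dμ_{C^{(k)}(Z₀0)}(B) exp(−⟨B, Γ_k(Z₀,0)X⟩ +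
½α₅‖Z₀B‖²)`, (2.23) where `α₅ = O(1)e^{−1/3δ₀M} + O(α₀ + α₁) + O(1)α₄ + γ₂`."*

WHAT IS REPRODUCED (unit `lit-balaban-r10` gen 8, B13 fold owner; SKELETON rows `B13.Eq2.16`, `B13.Eq2.17`,
`B13.Eq2.21` (consumed in their printed shapes), `B13.Eq2.15` → `B13.Def2.23` (the passage), of
`HOME/lit-balaban-r10/ROWS-B13.md`, HOME = `run/shared/lean/pub/lit-balaban/`).  The STARTING POINT is the right side
of (2.15) after its first line, as the tree has it: the conclusion of `B13FirstEstimate215.norm_core214_le_215` — the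
`dμ₀`-mean over `X` of `exp(−½Re⟨Γ_σX, A⁻¹Γ_σX⟩) · |det A/det Re A|^{1/2} · ∫dμ_{(Re A)⁻¹}(B) e^{−⟨B, Re Γ_σX⟩}ψ(B)`
(`A = C^{(k)}(Z₀,σ(Z))⁻¹` complex symmetric with `Re A ≻ 0`, `Γ_σ = Γ_k(Z₀,σ(Z))`, `ψ ≥ ‖F‖` a majorant of the last
line).  The END POINT is the display (2.23) as the tree has it: `B13Integral223.integral223 C Γ₀ α₅` (`C =
C^{(k)}(Z₀,0) ≻ 0` the new covariance, `Γ₀ = Γ_k(Z₀,0)` real; `B13GaugeDevices` §H model).  In between, exactly the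
printed replacements, each error entered AS A HYPOTHESIS IN ITS PRINTED SHAPE ((2.21) for the forms, (2.17) for the
determinants; §6 derives these shapes from (2.16)-type bounds):
* §1 **the change of Gaussian reference measure, exact** (*"the next Gaussian measure is replaced by the measure with
  the new covariance, multiplied by a quotient of determinants … and by the function exp ½⟨B, R₂B⟩"*):
  `gaussMean_change` — `∫dμ_{M⁻¹} f = √(det M/det M₀) · ∫dμ_{M₀⁻¹} e^{½⟨B,(M₀−M)B⟩} f` for positive definite
  precisions `M` (= `Re A`), `M₀` (= `C⁻¹`), so `R₂ = C⁻¹ − Re A`; `gaussNorm_div_gaussNorm` (the quotient of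
  determinants).  §2 `gaussMean_mono`, `gaussMean_nonneg` (general precision).
* §3 **the replacement, pointwise**: `innerMean_replace_le` (the `B`-integral: GIVEN `⟨B,R₂B⟩ ≤ ρ‖B‖²`,
  `−⟨B, Re Γ_σX⟩ ≤ −⟨B, Γ₀X⟩ + ½ρ(‖X‖² + ‖B‖²)` (R₃) and `0 ≤ ψ ≤ K e^{½a‖B‖²}` (the last line after (2.20) +
  (2.22), `B13Integral223.norm_F214_le` / `majorant_F214_le`), `∫dμ_{(Re A)⁻¹}(B) e^{−⟨B,Re Γ_σX⟩}ψ ≤ √(det Re A/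
  det C⁻¹)·K e^{½ρ‖X‖²}·[B-integral of (2.23) at α₅ = 2ρ + a]`); `integrand215_replace_le` (adding R₁:
  `−½Re⟨Γ_σX, A⁻¹Γ_σX⟩ ≤ −½⟨Γ₀X, CΓ₀X⟩ + ½ρ‖X‖²`, and the two determinant factors `≤ e^{η|Λ|}`: the `X`-integrand
  of (2.15) is `≤ e^{2η|Λ|}·K·[integrand of (2.23) at α₅ = 2ρ + a]`).
* §4 **integrated**: `integrable_integrand223` (the (2.23)-integrand is `dμ₀`-integrable under the hypotheses of
  `B13Integral223.integral223_le` — continuity of the closed form (2.24) + the Gaussian majorant; PROVED, not assumed),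
  `replaced_le_integral223` (**the right side of (2.15) ≤ `e^{2η|Λ|}·K·`(2.23)** — the printed *"we obtain the
  following integral (2.23)"*, with `α₅ = 2ρ + a`, print: `α₅ = O(1)e^{−⅓δ₀M} + O(α₀+α₁) + O(1)α₄ + γ₂`, i.e.
  `ρ = O(1)e^{−⅓δ₀M} + O(α₀+α₁)`, `a = O(1)α₄ + γ₂`), `replaced_le_226` (then `≤ e^{2η|Λ|}K·e^{α₅c|Λ|}e^{α₅(1+2cg)|N|}`
  by `integral223_le` — the determinant factors (2.17) `e^{2η|Λ|}`, `η ≤ α₅`, `|Λ| ≤ |N|`, are part of the printed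
  `exp O(1)α₅|Z|` of (2.26)).
* §5 **for the objects of record of (2.14)** (`B13Term214`): `norm_core214_le_223` = `B13FirstEstimate215.
  norm_core214_le_215` ∘ `replaced_le_integral223` (`|∫dμ₀(X)|_Z lines 2–4 of (2.14)| ≤ e^{2η|Λ|}·K·(2.23)`), and
  `norm_core214_F214_le_223` for the printed last line `F = (−1)^{|P|}χ_{k,Y₀}χᶜ_{k,P}exp[Στ(Y)𝐕_k(Y,·)]` under
  (2.20) + (2.22): `≤ e^{2η|Λ|}·exp(−½γ₂(ε₁²/g_k²)|P| + O(1)α₄M⁻⁴|Y₀|)·(2.23)` at `α₅ = 2ρ + γ₂ + a`.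
* §6 **the hypotheses from (2.16)-type bounds** (`B13PerturbativeStep`'s weighted row sums `WRS κ d R θ` = *"R
  satisfying (2.16)"* with constant `θ`): `abs_quadForm_le_of_WRS` and the RECTANGULAR Schur bound `abs_bilinForm_le`
  ((2.21)); `hR1_of_WRS`, `hR2_of_WRS`, `hR3_of_rowSum` (the three form hypotheses with `ρ = θ`); `h17b_of_WRS`
  (`√(det Re A/det C⁻¹) ≤ e^{½Kθ|Λ|}`) and `h17a_of_WRS` (`|det A/det Re A|^{1/2} ≤ e^{½Kθ(1+(1−Kθ)⁻¹)|Λ|}` for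
  `A = C⁻¹ + E`, `WRS C K`, `WRS E θ`, `Kθ < 1`) — (2.17) for both printed uses, from `B13PerturbativeStep.
  norm_det_add_le` / `norm_det_le_norm_det_add` / `sqrt_det_ratio_le`.
HONEST SCOPE.  What is NOT reproduced and stays by assertion (cell locus L16a, `B13PerturbativeStep` header «NOT
REPRODUCED — LOCATED»): the LEAF (2.16) itself — that the differences between the analytically continued operators
`C^{(k)}(Z₀,σ(Z))^{±1}`, `Γ_k(Z₀,σ(Z))` at `(𝐔, 𝐉)` and their values at `σ(Z) = 0`, `(U, 0)` have (2.16)-type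
kernels with `θ = O(1)e^{−⅓δ₀M} + O(α₀+α₁)` (random-walk expansions of [13]/[15] + a Cauchy estimate,
`B13PerturbativeStep` §7), and the lattice sum turning entrywise decay into row sums; (2.20) and (2.22) enter as
hypotheses in their printed shapes (rows B13.Eq2.20 `B13Resum220.ineq220`, B13.Eq2.22 `B13.indicator_le_exp_222`
discharge them for the lattice objects); integrability of the two (2.15)-majorants is carried (`hg215`, `hX215`) as
in `B13FirstEstimate215`; the Cauchy prefactors of line 1 of (2.15) are `B13CauchyDecay.norm_term214_le_215` (gen 7).
`R₁` is entered through its defining identity `Re⟨Γ_σX, A⁻¹Γ_σX⟩ = ⟨Γ₀X, CΓ₀X⟩ − ⟨X, R₁X⟩` (print: *"the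
difference is a quadratic form ½⟨X, R₁X⟩"*), `R₃` through `Re Γ_σ = Γ₀ + R₃`.  Every declaration is a proved
`theorem`; no `sorry`, no definition, no new named fact (D-0026); display-specific statements carry the locator,
plumbing is tagged "(elementary API for (2.xx))".

v1.1 (unit `lit-balaban-r10` gen 9; APPEND-ONLY — the v1 declarations are byte-identical): §7 DISCHARGES the two
integrability side conditions `hg215`/`hX215` of §5 (and of `B13FirstEstimate215.norm_core214_le_215`) for the chain
(2.14) → (2.23) → (2.26): (2.15) is applied with the Gaussian majorant `K e^{½a‖B‖²}` of the last line itself, whose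
`B`-integrability against the weight of `Re C^{(k)}(Z₀,σ(Z))⁻¹` follows from `R₂` + `C⁻¹ − (ρ+a)I ≻ 0` by domination with
the `B`-integrand of (2.23) (`integrable_hg215_gauss`), and whose `X`-majorant is measurable (Fubini measurability of the
parametric `B`-integral, `stronglyMeasurable_gaussMean_param`, given continuity of `X ↦ Γ_k(Z₀,σ(Z))X` — the printed
operator is linear, `continuous_Gamma214`) and dominated by `e^{2η|Λ|}K·`[(2.23)-integrand] (`integrable_hX215_gauss`);
hence `norm_core214_le_223_of_continuous`, `norm_core214_le_226_of_continuous`, `norm_core214_F214_le_223_of_continuous`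
— §5 with `hg215`, `hX215` replaced by `Continuous Γσ`.  Nothing measurable is asked of `F` or `ψ`.
-/

noncomputable section

namespace Literature.MathematicalPhysics.QuantumFieldTheory.Balaban1983to89.B13Replacement223

open Matrix MeasureTheory Finset
open scoped Real
open B13GaugeDevices (gaussWeight gaussInt gaussNorm gaussMean)
open B2Eq228Conditioning (gaussNorm_eq gaussNorm_pos gaussNorm_nonneg integrable_gaussWeight)
open B13Integral223 (innerB integral223 posDef_inv_sub_smul innerB_eq_224 innerB_nonneg integrand223_le
  integral223_le gaussMean_const_mul gaussMean_one_mono integrable_weight_one_mul_exp_sq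
  integrable_weight_mul_integrand dotProduct_self_nonneg')

variable {Λ N : Type} [Fintype Λ] [Fintype N] [DecidableEq Λ] [DecidableEq N]

/-! ## §1. The change of Gaussian reference measure (exact) -/

omit [DecidableEq Λ] in
/-- The weight of precision `M` against the weight of precision `M₀`: `e^{−½⟨B,MB⟩} = e^{−½⟨B,M₀B⟩}·e^{½⟨B,(M₀−M)B⟩}`
(*"… and by the function exp ½⟨B, R₂B⟩"*, `R₂ = M₀ − M`). [cite: Balaban1988RG2Cluster, (2.16)–(2.17) p.16]
(elementary API for (2.17)) -/
theorem gaussWeight_eq_mul (M M₀ : Matrix Λ Λ ℝ) (B : Λ → ℝ) :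
    gaussWeight M B = gaussWeight M₀ B * Real.exp (1 / 2 * (B ⬝ᵥ ((M₀ - M) *ᵥ B))) := by
  rw [gaussWeight, gaussWeight, ← Real.exp_add, sub_mulVec, dotProduct_sub]
  congr 1
  ring

omit [DecidableEq Λ] in
/-- The un-normalised integral against `e^{−½⟨B,MB⟩}` is the un-normalised integral against `e^{−½⟨B,M₀B⟩}` of the
integrand times `e^{½⟨B,(M₀−M)B⟩}` (no integrability needed). [cite: Balaban1988RG2Cluster, (2.16)–(2.17) p.16]
(elementary API for (2.17)) -/
theorem gaussInt_eq_gaussInt (M M₀ : Matrix Λ Λ ℝ) (f : (Λ → ℝ) → ℝ) :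
    gaussInt M f = gaussInt M₀ (fun B => Real.exp (1 / 2 * (B ⬝ᵥ ((M₀ - M) *ᵥ B))) * f B) := by
  rw [gaussInt, gaussInt]
  refine integral_congr_ae (Filter.Eventually.of_forall fun B => ?_)
  show gaussWeight M B • f B = gaussWeight M₀ B • (Real.exp (1 / 2 * (B ⬝ᵥ ((M₀ - M) *ᵥ B))) * f B)
  rw [smul_eq_mul, smul_eq_mul, gaussWeight_eq_mul M M₀ B, mul_assoc]

/-- The quotient of the two normalisations is a quotient of determinants: `∫e^{−½⟨B,M₀B⟩}/∫e^{−½⟨B,MB⟩} =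
√(det M/det M₀)` for positive definite `M, M₀`. [cite: Balaban1988RG2Cluster, (2.17) p.16] (elementary API for (2.17)) -/
theorem gaussNorm_div_gaussNorm {M M₀ : Matrix Λ Λ ℝ} (hM : M.PosDef) (hM₀ : M₀.PosDef) :
    gaussNorm M₀ / gaussNorm M = Real.sqrt (M.det / M₀.det) := by
  rw [gaussNorm_eq hM, gaussNorm_eq hM₀, Real.sqrt_div' _ hM₀.det_pos.le]
  have h1 : 0 < Real.sqrt (2 * Real.pi) ^ Fintype.card Λ := pow_pos (Real.sqrt_pos.2 (by positivity)) _
  have h2 : 0 < Real.sqrt M.det := Real.sqrt_pos.2 hM.det_pos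
  have h3 : 0 < Real.sqrt M₀.det := Real.sqrt_pos.2 hM₀.det_pos
  field_simp

/-- **The change of Gaussian reference measure** (*"the next Gaussian measure is replaced by the measure with the
new covariance, multiplied by a quotient of determinants … and by the function exp ½⟨B, R₂B⟩"*): for positive
definite precisions `M` (= `Re C^{(k)}(Z₀,σ(Z))⁻¹`) and `M₀` (= `C^{(k)}(Z₀,0)⁻¹`) and any integrand `f`,
`∫dμ_{M⁻¹}(B) f(B) = √(det M/det M₀) · ∫dμ_{M₀⁻¹}(B) e^{½⟨B,(M₀ − M)B⟩} f(B)` — exact, `R₂ = M₀ − M`.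
[cite: Balaban1988RG2Cluster, (2.16)–(2.17) p.16] -/
theorem gaussMean_change {M M₀ : Matrix Λ Λ ℝ} (hM : M.PosDef) (hM₀ : M₀.PosDef) (f : (Λ → ℝ) → ℝ) :
    gaussMean M f = Real.sqrt (M.det / M₀.det)
      * gaussMean M₀ (fun B => Real.exp (1 / 2 * (B ⬝ᵥ ((M₀ - M) *ᵥ B))) * f B) := by
  rw [gaussMean, gaussMean, smul_eq_mul, smul_eq_mul, gaussInt_eq_gaussInt M M₀ f, ← gaussNorm_div_gaussNorm hM hM₀,
    ← mul_assoc]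
  congr 1
  rw [div_eq_mul_inv, mul_comm, ← mul_assoc, inv_mul_cancel₀ (gaussNorm_pos hM₀).ne', one_mul]

/-! ## §2. Means: monotonicity, positivity -/

omit [DecidableEq Λ] in
/-- Monotonicity of a normalised Gaussian mean for a non-negative integrand under a majorant integrable against the
weight (nothing asked of the minorant). [cite: Balaban1988RG2Cluster, (2.15) p.15] (elementary API for (2.15)) -/
theorem gaussMean_mono (M : Matrix Λ Λ ℝ) {f g : (Λ → ℝ) → ℝ} (hf0 : ∀ B, 0 ≤ f B) (hfg : ∀ B, f B ≤ g B)
    (hg : Integrable (fun B => gaussWeight M B * g B)) : gaussMean M f ≤ gaussMean M g := by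
  rw [gaussMean, gaussMean, gaussInt, gaussInt, smul_eq_mul, smul_eq_mul]
  refine mul_le_mul_of_nonneg_left ?_ (inv_nonneg.2 (gaussNorm_nonneg _))
  simp_rw [smul_eq_mul]
  refine integral_mono_of_nonneg (Filter.Eventually.of_forall fun B => ?_) hg
    (Filter.Eventually.of_forall fun B => ?_)
  · exact mul_nonneg (Real.exp_pos _).le (hf0 B)
  · exact mul_le_mul_of_nonneg_left (hfg B) (Real.exp_pos _).le

omit [DecidableEq Λ] in
/-- A normalised Gaussian mean of a non-negative function is non-negative (junk `0` included).
[cite: Balaban1988RG2Cluster, (2.15) p.15] (elementary API for (2.15)) -/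
theorem gaussMean_nonneg (M : Matrix Λ Λ ℝ) {f : (Λ → ℝ) → ℝ} (hf0 : ∀ B, 0 ≤ f B) : 0 ≤ gaussMean M f := by
  rw [gaussMean, gaussInt, smul_eq_mul]
  refine mul_nonneg (inv_nonneg.2 (gaussNorm_nonneg _)) (integral_nonneg fun B => ?_)
  simp only [Pi.zero_apply, smul_eq_mul]
  exact mul_nonneg (Real.exp_pos _).le (hf0 B)

/-! ## §3. The replacement under the integral: the right side of (2.15) ⇒ `e^{2η|Λ|}·K·`(2.23) -/

section Replace

variable {A : Matrix Λ Λ ℂ} {C : Matrix Λ Λ ℝ}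

/-- **The `B`-integral replaced** (p. 16: *"the next Gaussian measure is replaced by the measure with the new
covariance, multiplied by a quotient of determinants … and by the function exp ½⟨B, R₂B⟩ with R₂ satisfying (2.16).
In the second exponential the difference between the new bilinear form and the form in (2.15) is a bilinear form
−⟨B, R₃X⟩ with R₃ satisfying (2.16)"*, the forms then bounded by (2.21)): for the precision `Re A` (`A =
C^{(k)}(Z₀,σ(Z))⁻¹`), the new covariance `C = C^{(k)}(Z₀,0)`, a complex source `J` (`= Γ_k(Z₀,σ(Z))X`) and a real
one `J₀` (`= Γ_k(Z₀,0)X`), GIVEN `⟨B, R₂B⟩ ≤ ρ‖B‖²` (`R₂ = C⁻¹ − Re A`), `−⟨B, Re J⟩ ≤ −⟨B, J₀⟩ + ½ρ(s + ‖B‖²)`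
(`s` standing for `‖ZX‖²`) and a last line `0 ≤ ψ(B) ≤ K e^{½a‖B‖²}`:
`∫dμ_{(Re A)⁻¹}(B) e^{−⟨B,Re J⟩}ψ(B) ≤ √(det Re A/det C⁻¹) · K e^{½ρs} · ∫dμ_C(B) e^{−⟨B,J₀⟩ + ½(2ρ + a)‖B‖²}` — the
last factor being the `B`-integral of (2.23) (`B13Integral223.innerB C (2ρ + a) J₀`), provided `C⁻¹ − (2ρ + a)I ≻ 0`.
[cite: Balaban1988RG2Cluster, (2.16)–(2.21) p.16, (2.23) p.17] -/
theorem innerMean_replace_le (hA : (A.map Complex.re).PosDef) (hC : C.PosDef) (J : Λ → ℂ) (J₀ : Λ → ℝ)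
    {ρ a K s : ℝ} (hR2 : ∀ B : Λ → ℝ, B ⬝ᵥ ((C⁻¹ - A.map Complex.re) *ᵥ B) ≤ ρ * (B ⬝ᵥ B))
    (hR3 : ∀ B : Λ → ℝ, -(B ⬝ᵥ fun i => (J i).re) ≤ -(B ⬝ᵥ J₀) + ρ / 2 * (s + B ⬝ᵥ B))
    (ψ : (Λ → ℝ) → ℝ) (hψ0 : ∀ B, 0 ≤ ψ B) (hψ : ∀ B, ψ B ≤ K * Real.exp (a / 2 * (B ⬝ᵥ B)))
    (hα : (C⁻¹ - (2 * ρ + a) • (1 : Matrix Λ Λ ℝ)).PosDef) :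
    gaussMean (A.map Complex.re) (fun B => Real.exp (-(B ⬝ᵥ fun i => (J i).re)) * ψ B)
      ≤ Real.sqrt ((A.map Complex.re).det / C⁻¹.det)
          * (K * Real.exp (ρ / 2 * s) * innerB C (2 * ρ + a) J₀) := by
  rw [gaussMean_change hA hC.inv]
  refine mul_le_mul_of_nonneg_left ?_ (Real.sqrt_nonneg _)
  rw [innerB, ← gaussMean_const_mul]
  refine gaussMean_mono C⁻¹ (fun B => ?_) (fun B => ?_) ?_
  · exact mul_nonneg (Real.exp_pos _).le (mul_nonneg (Real.exp_pos _).le (hψ0 B))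
  · have h2 : 1 / 2 * (B ⬝ᵥ ((C⁻¹ - A.map Complex.re) *ᵥ B)) ≤ ρ / 2 * (B ⬝ᵥ B) := by
      have := hR2 B
      linarith
    calc Real.exp (1 / 2 * (B ⬝ᵥ ((C⁻¹ - A.map Complex.re) *ᵥ B)))
          * (Real.exp (-(B ⬝ᵥ fun i => (J i).re)) * ψ B)
        ≤ Real.exp (ρ / 2 * (B ⬝ᵥ B))
            * (Real.exp (-(B ⬝ᵥ J₀) + ρ / 2 * (s + B ⬝ᵥ B)) * (K * Real.exp (a / 2 * (B ⬝ᵥ B)))) :=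
          mul_le_mul (Real.exp_le_exp.2 h2)
            (mul_le_mul (Real.exp_le_exp.2 (hR3 B)) (hψ B) (hψ0 B) (Real.exp_pos _).le)
            (mul_nonneg (Real.exp_pos _).le (hψ0 B)) (Real.exp_pos _).le
      _ = K * Real.exp (ρ / 2 * s) * Real.exp (-(B ⬝ᵥ J₀) + (2 * ρ + a) / 2 * (B ⬝ᵥ B)) := by
          have e1 : Real.exp (ρ / 2 * (B ⬝ᵥ B)) * (Real.exp (-(B ⬝ᵥ J₀) + ρ / 2 * (s + B ⬝ᵥ B))
              * (K * Real.exp (a / 2 * (B ⬝ᵥ B))))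
              = K * (Real.exp (ρ / 2 * (B ⬝ᵥ B)) * Real.exp (-(B ⬝ᵥ J₀) + ρ / 2 * (s + B ⬝ᵥ B))
                * Real.exp (a / 2 * (B ⬝ᵥ B))) := by ring
          rw [e1, ← Real.exp_add, ← Real.exp_add, mul_assoc, ← Real.exp_add]
          congr 2
          ring
  · have hi := (integrable_weight_mul_integrand hC hα J₀).const_mul (K * Real.exp (ρ / 2 * s))
    refine hi.congr (Filter.Eventually.of_forall fun B => ?_)
    simp only
    ring

omit [DecidableEq N] in
/-- **The replacement, pointwise in `X`** (pp. 15–17: *"In the expression on the right-hand side we replace the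
operators by the corresponding operators with σ(Z) = 0, 𝐔 = U, 𝐉 = 0, and we estimate the error … Applying the above
estimates to the expressions under the integral in (2.15), we obtain the following integral"* (2.23)).  For the `X`-
integrand of the right side of (2.15) (after its first line; the conclusion of `B13FirstEstimate215.norm_integrand214_le_215`)
— `exp(−½Re⟨Γ_σX, A⁻¹Γ_σX⟩) · |det A/det Re A|^{1/2} · ∫dμ_{(Re A)⁻¹}(B) e^{−⟨B,Re Γ_σX⟩}ψ(B)` with `A =
C^{(k)}(Z₀,σ(Z))⁻¹`, `Γ_σ = Γ_k(Z₀,σ(Z))` — GIVEN the replacement errors in their printed shapes: `R₁` (*"For the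
quadratic form in the first exponential the difference is a quadratic form ½⟨X, R₁X⟩"*, bounded by (2.21)):
`−½Re⟨Γ_σX, A⁻¹Γ_σX⟩ ≤ −½⟨Γ₀X, CΓ₀X⟩ + ½ρ‖X‖²`; the determinant factor (*"The determinants in the next factor are
equal for the new operators, hence this factor can be estimated by"* (2.17)): `|det A/det Re A|^{1/2} ≤ e^{η|Λ|}`; the
quotient of determinants of the measure change (*"estimated by (2.17)"*): `√(det Re A/det C⁻¹) ≤ e^{η|Λ|}`; `R₂`,
`R₃` as in `innerMean_replace_le`; and the last line `0 ≤ ψ ≤ K e^{½a‖B‖²}` ((2.20) + (2.22)) — the integrand is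
`≤ e^{2η|Λ|} · K · [exp(−½⟨Γ₀X, CΓ₀X⟩ + ½α₅‖X‖²) · ∫dμ_C(B) e^{−⟨B,Γ₀X⟩ + ½α₅‖B‖²}]`, the integrand of (2.23)
(`B13Integral223.integral223 C Γ₀ α₅`) with `α₅ = 2ρ + a` (print: `α₅ = O(1)e^{−⅓δ₀M} + O(α₀+α₁) + O(1)α₄ + γ₂`),
provided `C⁻¹ − α₅I ≻ 0`, `a ≥ 0`. [cite: Balaban1988RG2Cluster, (2.15)–(2.17) pp.15–16, (2.21) p.16, (2.23) p.17] -/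
theorem integrand215_replace_le (hA : (A.map Complex.re).PosDef) (hC : C.PosDef) (Γσ : (N → ℝ) → (Λ → ℂ))
    (Γ₀ : Matrix Λ N ℝ) {ρ η a K : ℝ} (ha0 : 0 ≤ a) (hK : 0 ≤ K)
    (hR1 : ∀ X : N → ℝ, -(1 / 2) * ((Γσ X) ⬝ᵥ (A⁻¹ *ᵥ Γσ X)).re
      ≤ -(1 / 2 * ((Γ₀ *ᵥ X) ⬝ᵥ (C *ᵥ (Γ₀ *ᵥ X)))) + ρ / 2 * (X ⬝ᵥ X))
    (h17a : Real.sqrt (‖A.det‖ / (A.map Complex.re).det) ≤ Real.exp (η * Fintype.card Λ))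
    (h17b : Real.sqrt ((A.map Complex.re).det / C⁻¹.det) ≤ Real.exp (η * Fintype.card Λ))
    (hR2 : ∀ B : Λ → ℝ, B ⬝ᵥ ((C⁻¹ - A.map Complex.re) *ᵥ B) ≤ ρ * (B ⬝ᵥ B))
    (hR3 : ∀ (X : N → ℝ) (B : Λ → ℝ), -(B ⬝ᵥ fun i => (Γσ X i).re)
      ≤ -(B ⬝ᵥ (Γ₀ *ᵥ X)) + ρ / 2 * (X ⬝ᵥ X + B ⬝ᵥ B))
    (ψ : (Λ → ℝ) → ℝ) (hψ0 : ∀ B, 0 ≤ ψ B) (hψ : ∀ B, ψ B ≤ K * Real.exp (a / 2 * (B ⬝ᵥ B)))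
    (hα : (C⁻¹ - (2 * ρ + a) • (1 : Matrix Λ Λ ℝ)).PosDef) (X : N → ℝ) :
    Real.exp (-(1 / 2) * ((Γσ X) ⬝ᵥ (A⁻¹ *ᵥ Γσ X)).re)
        * (Real.sqrt (‖A.det‖ / (A.map Complex.re).det)
          * gaussMean (A.map Complex.re) (fun B => Real.exp (-(B ⬝ᵥ fun i => (Γσ X i).re)) * ψ B))
      ≤ Real.exp (2 * η * Fintype.card Λ) * K
        * (Real.exp (-(1 / 2 * ((Γ₀ *ᵥ X) ⬝ᵥ (C *ᵥ (Γ₀ *ᵥ X)))) + (2 * ρ + a) / 2 * (X ⬝ᵥ X))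
          * innerB C (2 * ρ + a) (Γ₀ *ᵥ X)) := by
  have hB := innerMean_replace_le hA hC (Γσ X) (Γ₀ *ᵥ X) hR2 (hR3 X) ψ hψ0 hψ hα
  have hI0 : 0 ≤ innerB C (2 * ρ + a) (Γ₀ *ᵥ X) := innerB_nonneg _ _ _
  have hKI : 0 ≤ K * Real.exp (ρ / 2 * (X ⬝ᵥ X)) * innerB C (2 * ρ + a) (Γ₀ *ᵥ X) :=
    mul_nonneg (mul_nonneg hK (Real.exp_pos _).le) hI0
  have hM0 : 0 ≤ gaussMean (A.map Complex.re) (fun B => Real.exp (-(B ⬝ᵥ fun i => (Γσ X i).re)) * ψ B) :=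
    gaussMean_nonneg _ fun B => mul_nonneg (Real.exp_pos _).le (hψ0 B)
  calc Real.exp (-(1 / 2) * ((Γσ X) ⬝ᵥ (A⁻¹ *ᵥ Γσ X)).re)
        * (Real.sqrt (‖A.det‖ / (A.map Complex.re).det)
          * gaussMean (A.map Complex.re) (fun B => Real.exp (-(B ⬝ᵥ fun i => (Γσ X i).re)) * ψ B))
      ≤ Real.exp (-(1 / 2 * ((Γ₀ *ᵥ X) ⬝ᵥ (C *ᵥ (Γ₀ *ᵥ X)))) + ρ / 2 * (X ⬝ᵥ X))
          * (Real.exp (η * Fintype.card Λ)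
            * (Real.exp (η * Fintype.card Λ) * (K * Real.exp (ρ / 2 * (X ⬝ᵥ X)) * innerB C (2 * ρ + a) (Γ₀ *ᵥ X)))) :=
        mul_le_mul (Real.exp_le_exp.2 (hR1 X))
          (mul_le_mul h17a (hB.trans (mul_le_mul_of_nonneg_right h17b hKI)) hM0 (Real.exp_pos _).le)
          (mul_nonneg (Real.sqrt_nonneg _) hM0) (Real.exp_pos _).le
    _ = Real.exp (2 * η * Fintype.card Λ) * K
          * (Real.exp (-(1 / 2 * ((Γ₀ *ᵥ X) ⬝ᵥ (C *ᵥ (Γ₀ *ᵥ X)))) + ρ * (X ⬝ᵥ X))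
            * innerB C (2 * ρ + a) (Γ₀ *ᵥ X)) := by
        have e1 : Real.exp (2 * η * Fintype.card Λ)
            = Real.exp (η * Fintype.card Λ) * Real.exp (η * Fintype.card Λ) := by
          rw [← Real.exp_add]; congr 1; ring
        have e2 : Real.exp (-(1 / 2 * ((Γ₀ *ᵥ X) ⬝ᵥ (C *ᵥ (Γ₀ *ᵥ X)))) + ρ * (X ⬝ᵥ X))
            = Real.exp (-(1 / 2 * ((Γ₀ *ᵥ X) ⬝ᵥ (C *ᵥ (Γ₀ *ᵥ X)))) + ρ / 2 * (X ⬝ᵥ X))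
              * Real.exp (ρ / 2 * (X ⬝ᵥ X)) := by
          rw [← Real.exp_add]; congr 1; ring
        rw [e1, e2]
        ring
    _ ≤ Real.exp (2 * η * Fintype.card Λ) * K
          * (Real.exp (-(1 / 2 * ((Γ₀ *ᵥ X) ⬝ᵥ (C *ᵥ (Γ₀ *ᵥ X)))) + (2 * ρ + a) / 2 * (X ⬝ᵥ X))
            * innerB C (2 * ρ + a) (Γ₀ *ᵥ X)) := by
        refine mul_le_mul_of_nonneg_left (mul_le_mul_of_nonneg_right (Real.exp_le_exp.2 ?_) hI0)
          (mul_nonneg (Real.exp_pos _).le hK)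
        nlinarith [dotProduct_self_nonneg' X]

end Replace

/-! ## §4. Integrated: `∫dμ₀(X)|_Z` of the right side of (2.15) ⇒ `e^{2η|Λ|}·K·`(2.23) ⇒ the (2.26) factor -/

section Integrate

variable {A : Matrix Λ Λ ℂ} {C : Matrix Λ Λ ℝ}

/-- The integrand of (2.23) is integrable against `dμ₀` under the hypotheses of `B13Integral223.integral223_le`
(`λ_k(C) ≤ c`, `αc ≤ ½`, `⟨ΓX, CΓX⟩ ≤ g‖X‖²`) and `α(1 + 2cg) < 1`: it is continuous (the closed form (2.24),
`B13Integral223.innerB_eq_224`) and dominated by the integrable Gaussian majorant of `integrand223_le`.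
[cite: Balaban1988RG2Cluster, (2.23)–(2.25) p.17] (elementary API for (2.23)) -/
theorem integrable_integrand223 (hC : C.PosDef) (Γ : Matrix Λ N ℝ) {α c g : ℝ} (hα0 : 0 ≤ α) (hc0 : 0 ≤ c)
    (hc : ∀ k, hC.1.eigenvalues k ≤ c) (hαc : α * c ≤ 1 / 2)
    (hΓ : ∀ X : N → ℝ, (Γ *ᵥ X) ⬝ᵥ (C *ᵥ (Γ *ᵥ X)) ≤ g * (X ⬝ᵥ X)) (ha : α * (1 + 2 * c * g) < 1) :
    Integrable (fun X : N → ℝ => gaussWeight (1 : Matrix N N ℝ) X *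
      (Real.exp (-(1 / 2 * ((Γ *ᵥ X) ⬝ᵥ (C *ᵥ (Γ *ᵥ X)))) + α / 2 * (X ⬝ᵥ X)) * innerB C α (Γ *ᵥ X))) := by
  have hαPD : (C⁻¹ - α • (1 : Matrix Λ Λ ℝ)).PosDef := posDef_inv_sub_smul hC hc (by linarith)
  refine Integrable.mono' (integrable_weight_one_mul_exp_sq ha (Real.exp (α * c * Fintype.card Λ))) ?_
    (Filter.Eventually.of_forall fun X => ?_)
  · have hform : (fun X : N → ℝ => gaussWeight (1 : Matrix N N ℝ) X *
        (Real.exp (-(1 / 2 * ((Γ *ᵥ X) ⬝ᵥ (C *ᵥ (Γ *ᵥ X)))) + α / 2 * (X ⬝ᵥ X)) * innerB C α (Γ *ᵥ X)))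
        = fun X : N → ℝ => Real.exp (-(1 / 2 * (X ⬝ᵥ ((1 : Matrix N N ℝ) *ᵥ X)))) *
          (Real.exp (-(1 / 2 * ((Γ *ᵥ X) ⬝ᵥ (C *ᵥ (Γ *ᵥ X)))) + α / 2 * (X ⬝ᵥ X))
            * (Real.sqrt (C⁻¹.det / (C⁻¹ - α • (1 : Matrix Λ Λ ℝ)).det)
              * Real.exp (1 / 2 * ((Γ *ᵥ X) ⬝ᵥ ((C⁻¹ - α • (1 : Matrix Λ Λ ℝ))⁻¹ *ᵥ (Γ *ᵥ X)))))) := by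
      funext X
      rw [innerB_eq_224 hC hαPD, gaussWeight]
    rw [hform]
    exact (by fun_prop : Continuous _).aestronglyMeasurable
  · rw [Real.norm_of_nonneg (mul_nonneg (B2Eq228Conditioning.gaussWeight_pos _ X).le
      (mul_nonneg (Real.exp_pos _).le (innerB_nonneg C α (Γ *ᵥ X))))]
    exact mul_le_mul_of_nonneg_left (integrand223_le hC Γ hα0 hc0 hc hαc hΓ X)
      (B2Eq228Conditioning.gaussWeight_pos _ X).le

/-- **(2.15) ⇒ (2.23), integrated** (p. 17: *"Applying the above estimates to the expressions under the integral in
(2.15), we obtain the following integral: (2.23)"*): under the hypotheses of `integrand215_replace_le` and of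
`B13Integral223.integral223_le` for `α₅ = 2ρ + a` (`λ_k(C) ≤ c`, `α₅c ≤ ½`, `⟨Γ₀X, CΓ₀X⟩ ≤ g‖X‖²`, `α₅(1 + 2cg)
< 1`), the `X`-integral of the right side of (2.15) — the conclusion of `B13FirstEstimate215.norm_core214_le_215` — is
`≤ e^{2η|Λ|} · K · ∫dμ₀(X)|_Z exp(−½⟨Γ₀X,CΓ₀X⟩ + ½α₅‖ZX‖²)·∫dμ_C(B) exp(−⟨B,Γ₀X⟩ + ½α₅‖Z₀B‖²)` =
`e^{2η|Λ|} · K · B13Integral223.integral223 C Γ₀ α₅`. [cite: Balaban1988RG2Cluster, (2.15) p.15, (2.23) p.17] -/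
theorem replaced_le_integral223 (hA : (A.map Complex.re).PosDef) (hC : C.PosDef) (Γσ : (N → ℝ) → (Λ → ℂ))
    (Γ₀ : Matrix Λ N ℝ) {ρ η a K c g : ℝ} (hρ0 : 0 ≤ ρ) (ha0 : 0 ≤ a) (hK : 0 ≤ K)
    (hR1 : ∀ X : N → ℝ, -(1 / 2) * ((Γσ X) ⬝ᵥ (A⁻¹ *ᵥ Γσ X)).re
      ≤ -(1 / 2 * ((Γ₀ *ᵥ X) ⬝ᵥ (C *ᵥ (Γ₀ *ᵥ X)))) + ρ / 2 * (X ⬝ᵥ X))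
    (h17a : Real.sqrt (‖A.det‖ / (A.map Complex.re).det) ≤ Real.exp (η * Fintype.card Λ))
    (h17b : Real.sqrt ((A.map Complex.re).det / C⁻¹.det) ≤ Real.exp (η * Fintype.card Λ))
    (hR2 : ∀ B : Λ → ℝ, B ⬝ᵥ ((C⁻¹ - A.map Complex.re) *ᵥ B) ≤ ρ * (B ⬝ᵥ B))
    (hR3 : ∀ (X : N → ℝ) (B : Λ → ℝ), -(B ⬝ᵥ fun i => (Γσ X i).re)
      ≤ -(B ⬝ᵥ (Γ₀ *ᵥ X)) + ρ / 2 * (X ⬝ᵥ X + B ⬝ᵥ B))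
    (ψ : (Λ → ℝ) → ℝ) (hψ0 : ∀ B, 0 ≤ ψ B) (hψ : ∀ B, ψ B ≤ K * Real.exp (a / 2 * (B ⬝ᵥ B)))
    (hc0 : 0 ≤ c) (hc : ∀ k, hC.1.eigenvalues k ≤ c) (hαc : (2 * ρ + a) * c ≤ 1 / 2)
    (hΓ : ∀ X : N → ℝ, (Γ₀ *ᵥ X) ⬝ᵥ (C *ᵥ (Γ₀ *ᵥ X)) ≤ g * (X ⬝ᵥ X))
    (hsmall : (2 * ρ + a) * (1 + 2 * c * g) < 1) :
    gaussMean (1 : Matrix N N ℝ) (fun X =>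
        Real.exp (-(1 / 2) * ((Γσ X) ⬝ᵥ (A⁻¹ *ᵥ Γσ X)).re)
          * (Real.sqrt (‖A.det‖ / (A.map Complex.re).det)
            * gaussMean (A.map Complex.re) (fun B => Real.exp (-(B ⬝ᵥ fun i => (Γσ X i).re)) * ψ B)))
      ≤ Real.exp (2 * η * Fintype.card Λ) * K * integral223 C Γ₀ (2 * ρ + a) := by
  have hα0 : 0 ≤ 2 * ρ + a := by linarith
  have hα : (C⁻¹ - (2 * ρ + a) • (1 : Matrix Λ Λ ℝ)).PosDef := posDef_inv_sub_smul hC hc (by linarith)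
  rw [integral223, ← gaussMean_const_mul]
  refine gaussMean_one_mono (fun X => ?_)
    (fun X => integrand215_replace_le hA hC Γσ Γ₀ ha0 hK hR1 h17a h17b hR2 hR3 ψ hψ0 hψ hα X) ?_
  · exact mul_nonneg (Real.exp_pos _).le (mul_nonneg (Real.sqrt_nonneg _)
      (gaussMean_nonneg _ fun B => mul_nonneg (Real.exp_pos _).le (hψ0 B)))
  · have hi := (integrable_integrand223 hC Γ₀ hα0 hc0 hc hαc hΓ hsmall).const_mul
      (Real.exp (2 * η * Fintype.card Λ) * K)
    refine hi.congr (Filter.Eventually.of_forall fun X => ?_)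
    simp only
    ring

/-- **(2.15) ⇒ the last factor of (2.26)** (p. 17: *"These calculations and estimates yield … This ends the estimate
of the expression (2.14). Gathering together all the bounds we get"* (2.26)): under the same hypotheses with
`α₅(1 + 2cg) ≤ ½`, the `X`-integral of the right side of (2.15) is `≤ e^{2η|Λ|}·K·e^{α₅c|Λ|}·e^{α₅(1+2cg)|N|}` —
`B13Integral223.integral223_le` inserted; with `K = e^{−½γ₂ε₁²g_k⁻²|P| + O(1)α₄M⁻⁴|Y₀|}` (`B13Integral223.norm_F214_le`)
and `η ≤ α₅`, `|Λ| ≤ |N|` this is the printed `exp(−½γ₂ε₁²g_k⁻²|P|)·exp O(1)α₅|Z|`.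
[cite: Balaban1988RG2Cluster, (2.15) p.15, (2.23)–(2.26) p.17] -/
theorem replaced_le_226 (hA : (A.map Complex.re).PosDef) (hC : C.PosDef) (Γσ : (N → ℝ) → (Λ → ℂ))
    (Γ₀ : Matrix Λ N ℝ) {ρ η a K c g : ℝ} (hρ0 : 0 ≤ ρ) (ha0 : 0 ≤ a) (hK : 0 ≤ K)
    (hR1 : ∀ X : N → ℝ, -(1 / 2) * ((Γσ X) ⬝ᵥ (A⁻¹ *ᵥ Γσ X)).re
      ≤ -(1 / 2 * ((Γ₀ *ᵥ X) ⬝ᵥ (C *ᵥ (Γ₀ *ᵥ X)))) + ρ / 2 * (X ⬝ᵥ X))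
    (h17a : Real.sqrt (‖A.det‖ / (A.map Complex.re).det) ≤ Real.exp (η * Fintype.card Λ))
    (h17b : Real.sqrt ((A.map Complex.re).det / C⁻¹.det) ≤ Real.exp (η * Fintype.card Λ))
    (hR2 : ∀ B : Λ → ℝ, B ⬝ᵥ ((C⁻¹ - A.map Complex.re) *ᵥ B) ≤ ρ * (B ⬝ᵥ B))
    (hR3 : ∀ (X : N → ℝ) (B : Λ → ℝ), -(B ⬝ᵥ fun i => (Γσ X i).re)
      ≤ -(B ⬝ᵥ (Γ₀ *ᵥ X)) + ρ / 2 * (X ⬝ᵥ X + B ⬝ᵥ B))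
    (ψ : (Λ → ℝ) → ℝ) (hψ0 : ∀ B, 0 ≤ ψ B) (hψ : ∀ B, ψ B ≤ K * Real.exp (a / 2 * (B ⬝ᵥ B)))
    (hc0 : 0 ≤ c) (hc : ∀ k, hC.1.eigenvalues k ≤ c) (hαc : (2 * ρ + a) * c ≤ 1 / 2) (hg : 0 ≤ g)
    (hΓ : ∀ X : N → ℝ, (Γ₀ *ᵥ X) ⬝ᵥ (C *ᵥ (Γ₀ *ᵥ X)) ≤ g * (X ⬝ᵥ X))
    (hsmall : (2 * ρ + a) * (1 + 2 * c * g) ≤ 1 / 2) :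
    gaussMean (1 : Matrix N N ℝ) (fun X =>
        Real.exp (-(1 / 2) * ((Γσ X) ⬝ᵥ (A⁻¹ *ᵥ Γσ X)).re)
          * (Real.sqrt (‖A.det‖ / (A.map Complex.re).det)
            * gaussMean (A.map Complex.re) (fun B => Real.exp (-(B ⬝ᵥ fun i => (Γσ X i).re)) * ψ B)))
      ≤ Real.exp (2 * η * Fintype.card Λ) * K
        * (Real.exp ((2 * ρ + a) * c * Fintype.card Λ)
          * Real.exp ((2 * ρ + a) * (1 + 2 * c * g) * Fintype.card N)) :=
  (replaced_le_integral223 hA hC Γσ Γ₀ hρ0 ha0 hK hR1 h17a h17b hR2 hR3 ψ hψ0 hψ hc0 hc hαc hΓ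
      (by linarith)).trans
    (mul_le_mul_of_nonneg_left (integral223_le hC Γ₀ (by linarith) hc0 hc hαc hg hΓ hsmall)
      (mul_nonneg (Real.exp_pos _).le hK))

end Integrate

/-! ## §5. For the objects of record of (2.14): `|∫dμ₀(X)|_Z (lines 2–4 of (2.14))| ≤ e^{2η|Λ|}·K·`(2.23) -/

section Record

open B13Term214 (cgaussMean integrand214 F214)
open B13FirstEstimate215 (norm_core214_le_215)

variable {C₀ : Type} [Fintype C₀] [DecidableEq C₀] {A : Matrix Λ Λ ℂ} {C : Matrix Λ Λ ℝ}

/-- **The modulus of the `X`-integral of lines 2–4 of (2.14) is bounded by `e^{2η|Λ|}·K·`(2.23)**: the chain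
`B13FirstEstimate215.norm_core214_le_215` ((2.15), lines 2–4) → `replaced_le_integral223` (the perturbative
replacement of pp. 15–17) for the objects of record `B13Term214.cgaussMean 1 (integrand214 A Γ_σ F)` with a last line
`‖F‖ ≤ ψ ≤ K e^{½a‖B‖²}`; integrability of the two (2.15)-majorants carried as hypotheses (`hg215`, `hX215`), as in
`B13FirstEstimate215`. [cite: Balaban1988RG2Cluster, (2.14)–(2.15) p.15, (2.23) p.17] -/
theorem norm_core214_le_223 (hAs : A.IsSymm) (hA : (A.map Complex.re).PosDef) (hC : C.PosDef)
    (Γσ : (Λ ⊕ C₀ → ℝ) → (Λ → ℂ)) (Γ₀ : Matrix Λ (Λ ⊕ C₀) ℝ) (F : (Λ → ℝ) → ℂ) (ψ : (Λ → ℝ) → ℝ)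
    (hF : ∀ B, ‖F B‖ ≤ ψ B) {ρ η a K c g : ℝ} (hρ0 : 0 ≤ ρ) (ha0 : 0 ≤ a) (hK : 0 ≤ K)
    (hψ : ∀ B, ψ B ≤ K * Real.exp (a / 2 * (B ⬝ᵥ B)))
    (hR1 : ∀ X : Λ ⊕ C₀ → ℝ, -(1 / 2) * ((Γσ X) ⬝ᵥ (A⁻¹ *ᵥ Γσ X)).re
      ≤ -(1 / 2 * ((Γ₀ *ᵥ X) ⬝ᵥ (C *ᵥ (Γ₀ *ᵥ X)))) + ρ / 2 * (X ⬝ᵥ X))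
    (h17a : Real.sqrt (‖A.det‖ / (A.map Complex.re).det) ≤ Real.exp (η * Fintype.card Λ))
    (h17b : Real.sqrt ((A.map Complex.re).det / C⁻¹.det) ≤ Real.exp (η * Fintype.card Λ))
    (hR2 : ∀ B : Λ → ℝ, B ⬝ᵥ ((C⁻¹ - A.map Complex.re) *ᵥ B) ≤ ρ * (B ⬝ᵥ B))
    (hR3 : ∀ (X : Λ ⊕ C₀ → ℝ) (B : Λ → ℝ), -(B ⬝ᵥ fun i => (Γσ X i).re)
      ≤ -(B ⬝ᵥ (Γ₀ *ᵥ X)) + ρ / 2 * (X ⬝ᵥ X + B ⬝ᵥ B))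
    (hc0 : 0 ≤ c) (hc : ∀ k, hC.1.eigenvalues k ≤ c) (hαc : (2 * ρ + a) * c ≤ 1 / 2)
    (hΓ : ∀ X : Λ ⊕ C₀ → ℝ, (Γ₀ *ᵥ X) ⬝ᵥ (C *ᵥ (Γ₀ *ᵥ X)) ≤ g * (X ⬝ᵥ X))
    (hsmall : (2 * ρ + a) * (1 + 2 * c * g) < 1)
    (hg215 : ∀ X : Λ ⊕ C₀ → ℝ, Integrable (fun B : Λ → ℝ =>
      gaussWeight (A.map Complex.re) B * (Real.exp (-(B ⬝ᵥ fun i => (Γσ X i).re)) * ψ B)))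
    (hX215 : Integrable (fun X : Λ ⊕ C₀ → ℝ => gaussWeight (1 : Matrix (Λ ⊕ C₀) (Λ ⊕ C₀) ℝ) X *
      (Real.exp (-(1 / 2) * ((Γσ X) ⬝ᵥ (A⁻¹ *ᵥ Γσ X)).re)
        * (Real.sqrt (‖A.det‖ / (A.map Complex.re).det)
          * gaussMean (A.map Complex.re) (fun B => Real.exp (-(B ⬝ᵥ fun i => (Γσ X i).re)) * ψ B))))) :
    ‖cgaussMean (1 : Matrix (Λ ⊕ C₀) (Λ ⊕ C₀) ℂ) (fun X => integrand214 A Γσ F X)‖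
      ≤ Real.exp (2 * η * Fintype.card Λ) * K * integral223 C Γ₀ (2 * ρ + a) :=
  (norm_core214_le_215 hAs hA Γσ F ψ hF hg215 hX215).trans
    (replaced_le_integral223 hA hC Γσ Γ₀ hρ0 ha0 hK hR1 h17a h17b hR2 hR3 ψ
      (fun B => (norm_nonneg _).trans (hF B)) hψ hc0 hc hαc hΓ hsmall)

omit [Fintype Λ] [DecidableEq Λ] in
/-- **The printed last line has the shape `ψ(B) ≤ K e^{½a′‖B‖²}` under (2.20) + (2.22)** (the real-majorant twin of
`B13Integral223.norm_F214_le`): if `χ_{k,Y₀}χᶜ_{k,P} ≤ exp(−½γ₂(ε₁²/g_k²)|P| + ½γ₂‖PB‖²)` with `‖PB‖² ≤ ‖Z₀B‖²`,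
((2.22); the signs of the factors are not needed here), and `Σ_{Y∈𝐃}|τ(Y)||𝐕_k(Y,B)| ≤ ½a‖Z₀B‖² + w` ((2.20)), then
`χ_{k,Y₀}(B)χᶜ_{k,P}(B)·exp[Σ|τ(Y)||𝐕_k(Y,B)|] ≤ exp(−½γ₂(ε₁²/g_k²)|P| + w)·exp(½(γ₂ + a)‖Z₀B‖²)`.
[cite: Balaban1988RG2Cluster, (2.20)–(2.22) p.16] -/
theorem majorant_F214_le {D : Type*} [Fintype Λ] (cardP : ℕ) (χY₀ χcP : (Λ → ℝ) → ℝ) (Dfam : Finset D)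
    (V : D → (Λ → ℝ) → ℂ) (τ : D → ℂ) {γ₂ r a w : ℝ} (qP : (Λ → ℝ) → ℝ) (B : Λ → ℝ)
    (h222 : χY₀ B * χcP B ≤ Real.exp (-(γ₂ / 2 * r ^ 2 * cardP) + γ₂ / 2 * qP B)) (hγ₂ : 0 ≤ γ₂) (hqP : qP B ≤ B ⬝ᵥ B) (h220 : ∑ Y ∈ Dfam, ‖τ Y‖ * ‖V Y B‖ ≤ a / 2 * (B ⬝ᵥ B) + w) :
    χY₀ B * χcP B * Real.exp (∑ Y ∈ Dfam, ‖τ Y‖ * ‖V Y B‖)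
      ≤ Real.exp (-(γ₂ / 2 * r ^ 2 * cardP) + w) * Real.exp ((γ₂ + a) / 2 * (B ⬝ᵥ B)) := by
  have h1 : χY₀ B * χcP B ≤ Real.exp (-(γ₂ / 2 * r ^ 2 * cardP) + γ₂ / 2 * (B ⬝ᵥ B)) :=
    h222.trans (Real.exp_le_exp.2 (by nlinarith))
  calc χY₀ B * χcP B * Real.exp (∑ Y ∈ Dfam, ‖τ Y‖ * ‖V Y B‖)
      ≤ Real.exp (-(γ₂ / 2 * r ^ 2 * cardP) + γ₂ / 2 * (B ⬝ᵥ B)) * Real.exp (a / 2 * (B ⬝ᵥ B) + w) :=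
        mul_le_mul h1 (Real.exp_le_exp.2 h220) (Real.exp_pos _).le (Real.exp_pos _).le
    _ = Real.exp (-(γ₂ / 2 * r ^ 2 * cardP) + w) * Real.exp ((γ₂ + a) / 2 * (B ⬝ᵥ B)) := by
        rw [← Real.exp_add, ← Real.exp_add]
        ring_nf

/-- **(2.14) ⇒ (2.26) without the Cauchy prefactors, for the printed last line**: for `F = (−1)^{|P|}χ_{k,Y₀}χᶜ_{k,P}
exp[Στ(Y)𝐕_k(Y,·)]` (`B13Term214.F214`) under (2.22) and (2.20) (as in `majorant_F214_le`, for every `B`) and the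
replacement hypotheses of `replaced_le_integral223` with `a′ = γ₂ + a`:
`|∫dμ₀(X)|_Z (lines 2–4 of (2.14))| ≤ e^{2η|Λ|} · exp(−½γ₂(ε₁²/g_k²)|P| + w) · (2.23)` at `α₅ = 2ρ + γ₂ + a` — the
factor `exp(−½γ₂ε₁²g_k⁻²|P|)` of (2.26) and the Gaussian integral (2.23) whose bound `exp O(1)α₅|Z|` is
`B13Integral223.integral223_le_226`. [cite: Balaban1988RG2Cluster, (2.14)–(2.15) p.15, (2.20)–(2.22) p.16, (2.23)–(2.26) p.17] -/
theorem norm_core214_F214_le_223 {D : Type*} (hAs : A.IsSymm) (hA : (A.map Complex.re).PosDef) (hC : C.PosDef)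
    (Γσ : (Λ ⊕ C₀ → ℝ) → (Λ → ℂ)) (Γ₀ : Matrix Λ (Λ ⊕ C₀) ℝ) (cardP : ℕ) (χY₀ χcP : (Λ → ℝ) → ℝ)
    (hχ0 : ∀ B, 0 ≤ χY₀ B) (hχc0 : ∀ B, 0 ≤ χcP B) (Dfam : Finset D) (V : D → (Λ → ℝ) → ℂ) (τ : D → ℂ)
    {γ₂ r a w : ℝ} (qP : (Λ → ℝ) → ℝ)
    (h222 : ∀ B, χY₀ B * χcP B ≤ Real.exp (-(γ₂ / 2 * r ^ 2 * cardP) + γ₂ / 2 * qP B)) (hγ₂ : 0 ≤ γ₂)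
    (hqP : ∀ B, qP B ≤ B ⬝ᵥ B) (h220 : ∀ B, ∑ Y ∈ Dfam, ‖τ Y‖ * ‖V Y B‖ ≤ a / 2 * (B ⬝ᵥ B) + w)
    {ρ η c g : ℝ} (hρ0 : 0 ≤ ρ) (ha0 : 0 ≤ a)
    (hR1 : ∀ X : Λ ⊕ C₀ → ℝ, -(1 / 2) * ((Γσ X) ⬝ᵥ (A⁻¹ *ᵥ Γσ X)).re
      ≤ -(1 / 2 * ((Γ₀ *ᵥ X) ⬝ᵥ (C *ᵥ (Γ₀ *ᵥ X)))) + ρ / 2 * (X ⬝ᵥ X))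
    (h17a : Real.sqrt (‖A.det‖ / (A.map Complex.re).det) ≤ Real.exp (η * Fintype.card Λ))
    (h17b : Real.sqrt ((A.map Complex.re).det / C⁻¹.det) ≤ Real.exp (η * Fintype.card Λ))
    (hR2 : ∀ B : Λ → ℝ, B ⬝ᵥ ((C⁻¹ - A.map Complex.re) *ᵥ B) ≤ ρ * (B ⬝ᵥ B))
    (hR3 : ∀ (X : Λ ⊕ C₀ → ℝ) (B : Λ → ℝ), -(B ⬝ᵥ fun i => (Γσ X i).re)
      ≤ -(B ⬝ᵥ (Γ₀ *ᵥ X)) + ρ / 2 * (X ⬝ᵥ X + B ⬝ᵥ B))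
    (hc0 : 0 ≤ c) (hc : ∀ k, hC.1.eigenvalues k ≤ c) (hαc : (2 * ρ + (γ₂ + a)) * c ≤ 1 / 2)
    (hΓ : ∀ X : Λ ⊕ C₀ → ℝ, (Γ₀ *ᵥ X) ⬝ᵥ (C *ᵥ (Γ₀ *ᵥ X)) ≤ g * (X ⬝ᵥ X))
    (hsmall : (2 * ρ + (γ₂ + a)) * (1 + 2 * c * g) < 1)
    (hg215 : ∀ X : Λ ⊕ C₀ → ℝ, Integrable (fun B : Λ → ℝ =>
      gaussWeight (A.map Complex.re) B * (Real.exp (-(B ⬝ᵥ fun i => (Γσ X i).re))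
        * (χY₀ B * χcP B * Real.exp (∑ Y ∈ Dfam, ‖τ Y‖ * ‖V Y B‖)))))
    (hX215 : Integrable (fun X : Λ ⊕ C₀ → ℝ => gaussWeight (1 : Matrix (Λ ⊕ C₀) (Λ ⊕ C₀) ℝ) X *
      (Real.exp (-(1 / 2) * ((Γσ X) ⬝ᵥ (A⁻¹ *ᵥ Γσ X)).re)
        * (Real.sqrt (‖A.det‖ / (A.map Complex.re).det)
          * gaussMean (A.map Complex.re) (fun B => Real.exp (-(B ⬝ᵥ fun i => (Γσ X i).re))
            * (χY₀ B * χcP B * Real.exp (∑ Y ∈ Dfam, ‖τ Y‖ * ‖V Y B‖))))))) :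
    ‖cgaussMean (1 : Matrix (Λ ⊕ C₀) (Λ ⊕ C₀) ℂ) (fun X => integrand214 A Γσ (F214 cardP χY₀ χcP Dfam V τ) X)‖
      ≤ Real.exp (2 * η * Fintype.card Λ) * Real.exp (-(γ₂ / 2 * r ^ 2 * cardP) + w)
        * integral223 C Γ₀ (2 * ρ + (γ₂ + a)) :=
  norm_core214_le_223 hAs hA hC Γσ Γ₀ _ _
    (fun B => B13FirstEstimate215.norm_F214_le_printed cardP χY₀ χcP Dfam V τ B (hχ0 B) (hχc0 B)) hρ0
    (by linarith) (Real.exp_pos _).le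
    (fun B => majorant_F214_le cardP χY₀ χcP Dfam V τ qP B (h222 B) hγ₂ (hqP B) (h220 B))
    hR1 h17a h17b hR2 hR3 hc0 hc hαc hΓ hsmall hg215 hX215

end Record

/-! ## §6. The hypotheses from (2.16)-type bounds: (2.21) by Schur, (2.17) by the Leibniz row-sum bound
(`B13PerturbativeStep` §4–§5) -/

section From216

open B13PerturbativeStep (WRS wrs WeightHyp norm_bilinForm_le_of_WRS rowSum_le_wrs)

variable {κ : ℝ}

/-- **(2.21) for a quadratic form**: a real square matrix `R` with `e^{κd}`-weighted absolute row sums `≤ θ` for `R`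
and `Rᵀ` (*"R₁, R₂ … satisfying (2.16)"*) has `|⟨v, Rv⟩| ≤ θ‖v‖²` (`B13PerturbativeStep.norm_bilinForm_le_of_WRS`
at `v = w`). [cite: Balaban1988RG2Cluster, (2.21) p.16] -/
theorem abs_quadForm_le_of_WRS {n : Type*} [Fintype n] {d : n → n → ℝ} (hw : WeightHyp κ d)
    {R : Matrix n n ℝ} {θ : ℝ} (hR : WRS κ d R θ) (hRt : WRS κ d Rᵀ θ) (v : n → ℝ) :
    |v ⬝ᵥ (R *ᵥ v)| ≤ θ * (v ⬝ᵥ v) := by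
  have h := norm_bilinForm_le_of_WRS hw hR hRt v v
  have e : ∑ i, ∑ j, v i * R i j * v j = v ⬝ᵥ (R *ᵥ v) := by
    simp only [dotProduct, mulVec, Finset.mul_sum]
    exact Finset.sum_congr rfl fun i _ => Finset.sum_congr rfl fun j _ => by ring
  have e2 : ∑ i, ‖v i‖ ^ 2 = v ⬝ᵥ v :=
    Finset.sum_congr rfl fun i _ => by rw [Real.norm_eq_abs, sq_abs, sq]
  rw [e, e2, Real.norm_eq_abs] at h
  linarith

/-- **(2.21) for a bilinear form between `B` and `X`** (*"a bilinear form −⟨B, R₃X⟩ with R₃ satisfying (2.16) … can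
be bounded … by the forms ½(…)(‖ZX‖² + ‖Z₀B‖²)"*): for a real RECTANGULAR matrix `R` (bonds of `Z₀` × bonds of `Z`)
with absolute row sums `≤ r` and absolute column sums `≤ c`, `|⟨v, Rw⟩| ≤ ½(r‖v‖² + c‖w‖²)` (Schur / AM–GM; the
rectangular twin of `B13PerturbativeStep.norm_bilinForm_le`). [cite: Balaban1988RG2Cluster, (2.21) p.16] -/
theorem abs_bilinForm_le {m n : Type*} [Fintype m] [Fintype n] (R : Matrix m n ℝ) (v : m → ℝ) (w : n → ℝ)
    {r c : ℝ} (hr : ∀ i, ∑ j, |R i j| ≤ r) (hc : ∀ j, ∑ i, |R i j| ≤ c) :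
    |v ⬝ᵥ (R *ᵥ w)| ≤ 1 / 2 * (r * (v ⬝ᵥ v) + c * (w ⬝ᵥ w)) := by
  have e : v ⬝ᵥ (R *ᵥ w) = ∑ i, ∑ j, v i * R i j * w j := by
    simp only [dotProduct, mulVec, Finset.mul_sum]
    exact Finset.sum_congr rfl fun i _ => Finset.sum_congr rfl fun j _ => by ring
  have ev : v ⬝ᵥ v = ∑ i, v i ^ 2 := Finset.sum_congr rfl fun i _ => by ring
  have ew : w ⬝ᵥ w = ∑ j, w j ^ 2 := Finset.sum_congr rfl fun j _ => by ring
  rw [e, ev, ew]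
  calc |∑ i, ∑ j, v i * R i j * w j| ≤ ∑ i, ∑ j, |R i j| * (|v i| * |w j|) := by
        refine (Finset.abs_sum_le_sum_abs _ _).trans (Finset.sum_le_sum fun i _ =>
          (Finset.abs_sum_le_sum_abs _ _).trans (Finset.sum_le_sum fun j _ => ?_))
        rw [abs_mul, abs_mul]
        exact le_of_eq (by ring)
    _ ≤ ∑ i, ∑ j, |R i j| * ((v i ^ 2 + w j ^ 2) / 2) :=
        Finset.sum_le_sum fun i _ => Finset.sum_le_sum fun j _ =>
          mul_le_mul_of_nonneg_left
            (by nlinarith [two_mul_le_add_sq |v i| |w j|, sq_abs (v i), sq_abs (w j)]) (abs_nonneg _)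
    _ = 1 / 2 * ∑ i, v i ^ 2 * ∑ j, |R i j| + 1 / 2 * ∑ j, w j ^ 2 * ∑ i, |R i j| := by
        have hsplit : ∀ i j, |R i j| * ((v i ^ 2 + w j ^ 2) / 2)
            = 1 / 2 * (v i ^ 2 * |R i j|) + 1 / 2 * (w j ^ 2 * |R i j|) := fun i j => by ring
        simp_rw [hsplit, Finset.sum_add_distrib, ← Finset.mul_sum]
        rw [Finset.sum_comm (f := fun i j => w j ^ 2 * |R i j|)]
        simp_rw [← Finset.mul_sum]
    _ ≤ 1 / 2 * (r * ∑ i, v i ^ 2 + c * ∑ j, w j ^ 2) := by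
        rw [mul_add]
        refine add_le_add (mul_le_mul_of_nonneg_left ?_ (by norm_num))
          (mul_le_mul_of_nonneg_left ?_ (by norm_num))
        · calc ∑ i, v i ^ 2 * ∑ j, |R i j| ≤ ∑ i, v i ^ 2 * r :=
              Finset.sum_le_sum fun i _ => mul_le_mul_of_nonneg_left (hr i) (by positivity)
            _ = r * ∑ i, v i ^ 2 := by rw [← Finset.sum_mul, mul_comm]
        · calc ∑ j, w j ^ 2 * ∑ i, |R i j| ≤ ∑ j, w j ^ 2 * c :=
              Finset.sum_le_sum fun j _ => mul_le_mul_of_nonneg_left (hc j) (by positivity)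
            _ = c * ∑ j, w j ^ 2 := by rw [← Finset.sum_mul, mul_comm]

variable {A : Matrix Λ Λ ℂ} {C : Matrix Λ Λ ℝ}

omit [DecidableEq N] in
/-- **The hypothesis `hR1` from (2.16) for `R₁`**: if the first quadratic form differs from the new one by
`½⟨X, R₁X⟩` (*"For the quadratic form in the first exponential the difference is a quadratic form ½⟨X, R₁X⟩, with
matrix elements satisfying the bound (2.16)"*) and `R₁`, `R₁ᵀ` have weighted row sums `≤ θ`, then
`−½Re⟨Γ_σX, A⁻¹Γ_σX⟩ ≤ −½⟨Γ₀X, CΓ₀X⟩ + ½θ‖X‖²`. [cite: Balaban1988RG2Cluster, (2.16) p.16, (2.21) p.16] -/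
theorem hR1_of_WRS {d : N → N → ℝ} (hw : WeightHyp κ d) (Γσ : (N → ℝ) → (Λ → ℂ)) (Γ₀ : Matrix Λ N ℝ)
    (R₁ : Matrix N N ℝ) {θ : ℝ}
    (hdef : ∀ X : N → ℝ, ((Γσ X) ⬝ᵥ (A⁻¹ *ᵥ Γσ X)).re = (Γ₀ *ᵥ X) ⬝ᵥ (C *ᵥ (Γ₀ *ᵥ X)) - X ⬝ᵥ (R₁ *ᵥ X))
    (h1 : WRS κ d R₁ θ) (h1t : WRS κ d R₁ᵀ θ) (X : N → ℝ) :
    -(1 / 2) * ((Γσ X) ⬝ᵥ (A⁻¹ *ᵥ Γσ X)).re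
      ≤ -(1 / 2 * ((Γ₀ *ᵥ X) ⬝ᵥ (C *ᵥ (Γ₀ *ᵥ X)))) + θ / 2 * (X ⬝ᵥ X) := by
  rw [hdef]
  have h := abs_quadForm_le_of_WRS hw h1 h1t X
  have h' := le_abs_self (X ⬝ᵥ (R₁ *ᵥ X))
  linarith

/-- **The hypothesis `hR2` from (2.16) for `R₂ = C⁻¹ − Re A`** (*"exp ½⟨B, R₂B⟩ with R₂ satisfying (2.16)"*):
weighted row sums of `R₂`, `R₂ᵀ` `≤ θ` give `⟨B, R₂B⟩ ≤ θ‖B‖²`. [cite: Balaban1988RG2Cluster, (2.16) p.16, (2.21) p.16] -/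
theorem hR2_of_WRS {d : Λ → Λ → ℝ} (hw : WeightHyp κ d) {θ : ℝ}
    (h2 : WRS κ d (C⁻¹ - A.map Complex.re) θ) (h2t : WRS κ d (C⁻¹ - A.map Complex.re)ᵀ θ) (B : Λ → ℝ) :
    B ⬝ᵥ ((C⁻¹ - A.map Complex.re) *ᵥ B) ≤ θ * (B ⬝ᵥ B) :=
  (le_abs_self _).trans (abs_quadForm_le_of_WRS hw h2 h2t B)

omit [DecidableEq Λ] [DecidableEq N] in
/-- **The hypothesis `hR3` from (2.16) for `R₃ = Re Γ_σ − Γ₀`** (*"the difference between the new bilinear form and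
the form in (2.15) is a bilinear form −⟨B, R₃X⟩ with R₃ satisfying (2.16)"*): if `Re Γ_σX = Γ₀X + R₃X` with the
absolute row and column sums of the rectangular `R₃` `≤ θ`, then `−⟨B, Re Γ_σX⟩ ≤ −⟨B, Γ₀X⟩ + ½θ(‖X‖² + ‖B‖²)`.
[cite: Balaban1988RG2Cluster, (2.16) p.16, (2.21) p.16] -/
theorem hR3_of_rowSum (Γσ : (N → ℝ) → (Λ → ℂ)) (Γ₀ R₃ : Matrix Λ N ℝ) {θ : ℝ}
    (hdef : ∀ (X : N → ℝ) (i : Λ), (Γσ X i).re = ((Γ₀ + R₃) *ᵥ X) i)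
    (hr : ∀ i, ∑ j, |R₃ i j| ≤ θ) (hc : ∀ j, ∑ i, |R₃ i j| ≤ θ) (X : N → ℝ) (B : Λ → ℝ) :
    -(B ⬝ᵥ fun i => (Γσ X i).re) ≤ -(B ⬝ᵥ (Γ₀ *ᵥ X)) + θ / 2 * (X ⬝ᵥ X + B ⬝ᵥ B) := by
  have hfun : (fun i => (Γσ X i).re) = (Γ₀ + R₃) *ᵥ X := funext (hdef X)
  rw [hfun, add_mulVec, dotProduct_add]
  have h := abs_bilinForm_le R₃ B X hr hc
  have h' := neg_abs_le (B ⬝ᵥ (R₃ *ᵥ X))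
  linarith

/-- **The quotient of determinants of the measure change, from (2.16)** (*"a quotient of determinants, which can be
estimated by (2.17)"*): `√(det Re A/det C⁻¹) ≤ exp(½Kθ·|Λ|)` when the new covariance `C` has weighted row sums
`≤ K` and `Re A − C⁻¹` (`= −R₂`) has weighted row sums `≤ θ`, `Kθ < 1` (`B13PerturbativeStep.sqrt_det_ratio_le`).
[cite: Balaban1988RG2Cluster, (2.17) p.16] -/
theorem h17b_of_WRS {d : Λ → Λ → ℝ} (hw : WeightHyp κ d) (hC : C.PosDef) (hA : (A.map Complex.re).PosDef)
    {K θ : ℝ} (hK : WRS κ d C K) (hE : WRS κ d (A.map Complex.re - C⁻¹) θ) (hKθ : K * θ < 1) :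
    Real.sqrt ((A.map Complex.re).det / C⁻¹.det) ≤ Real.exp (K * θ / 2 * Fintype.card Λ) := by
  have hu : IsUnit (C⁻¹ : Matrix Λ Λ ℝ) := (Matrix.isUnit_iff_isUnit_det _).2 hC.inv.det_pos.ne'.isUnit
  have hK' : WRS κ d (C⁻¹)⁻¹ K := by
    rw [Matrix.nonsing_inv_nonsing_inv C hC.det_pos.ne'.isUnit]; exact hK
  have h := B13PerturbativeStep.sqrt_det_ratio_le hw hu hK' hE hKθ
  rw [add_sub_cancel, Real.norm_of_nonneg hA.det_pos.le, Real.norm_of_nonneg hC.inv.det_pos.le] at h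
  refine h.trans (le_of_eq ?_)
  congr 1
  ring

omit [Fintype Λ] [DecidableEq Λ] in
/-- A real matrix and its complexification have the same weighted row sums. [folklore]
[cite: Balaban1988RG2Cluster, (2.16) p.16] (elementary API for (2.16)) -/
theorem WRS_map_ofReal [Fintype Λ] {d : Λ → Λ → ℝ} {M : Matrix Λ Λ ℝ} {ρ : ℝ} (h : WRS κ d M ρ) :
    WRS κ d (M.map (algebraMap ℝ ℂ)) ρ := fun i => by
  have hi := h i
  simp only [wrs, Matrix.map_apply, Complex.coe_algebraMap, Complex.norm_real] at hi ⊢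
  exact hi

/-- **The determinant factor of (2.15), from (2.16)** (*"The determinants in the next factor are equal for the new
operators, hence this factor can be estimated by (2.17)"*): writing `A = C⁻¹ + E` (`E` = the difference between the
analytically continued precision `C^{(k)}(Z₀,σ(Z))⁻¹` and `C^{(k)}(Z₀,0)⁻¹`), `Re A = C⁻¹ + Re E`; if `C` has
weighted row sums `≤ K` and `E` has weighted row sums `≤ θ` with `Kθ < 1`, then
`|det A/det Re A|^{1/2} ≤ exp(½Kθ(1 + (1 − Kθ)⁻¹)·|Λ|)` — the upper Leibniz bound for `det(C⁻¹ + E)/det C⁻¹` and the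
lower one for `det C⁻¹/det(C⁻¹ + Re E)` (`B13PerturbativeStep.norm_det_add_le`, `norm_det_le_norm_det_add`; `Re E`
inherits the bound, `WRS.map_re`). [cite: Balaban1988RG2Cluster, (2.17) p.16] -/
theorem h17a_of_WRS {d : Λ → Λ → ℝ} (hw : WeightHyp κ d) (hC : C.PosDef) (hA : (A.map Complex.re).PosDef)
    {K θ : ℝ} (hK : WRS κ d C K) (hE : WRS κ d (A - C⁻¹.map (algebraMap ℝ ℂ)) θ) (hKθ : K * θ < 1) :
    Real.sqrt (‖A.det‖ / (A.map Complex.re).det)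
      ≤ Real.exp (K * θ * (1 + (1 - K * θ)⁻¹) / 2 * Fintype.card Λ) := by
  have hCu : IsUnit C.det := hC.det_pos.ne'.isUnit
  -- the complexified `C⁻¹` and its inverse
  set A₀ : Matrix Λ Λ ℂ := C⁻¹.map (algebraMap ℝ ℂ) with hA₀
  have hmul : A₀ * C.map (algebraMap ℝ ℂ) = 1 := by
    rw [hA₀, ← Matrix.map_mul, Matrix.nonsing_inv_mul C hCu, Matrix.map_one _ (map_zero _) (map_one _)]
  have hA₀inv : A₀⁻¹ = C.map (algebraMap ℝ ℂ) := Matrix.inv_eq_right_inv hmul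
  have hA₀u : IsUnit A₀ := (Matrix.isUnit_iff_isUnit_det _).2
    (Matrix.isUnit_det_of_right_inverse hmul)
  have hK0 : WRS κ d A₀⁻¹ K := by rw [hA₀inv]; exact WRS_map_ofReal hK
  have hdetA₀ : ‖A₀.det‖ = C⁻¹.det := by
    rw [hA₀, ← RingHom.mapMatrix_apply, ← RingHom.map_det, Complex.coe_algebraMap, Complex.norm_real,
      Real.norm_of_nonneg hC.inv.det_pos.le]
  -- upper bound: ‖det A‖ ≤ det C⁻¹ · e^{nKθ}
  have hup := B13PerturbativeStep.norm_det_add_le hw hA₀u hK0 hE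
  rw [add_sub_cancel, hdetA₀] at hup
  -- lower bound: det C⁻¹ ≤ det(Re A) · e^{nKθ/(1−Kθ)}
  have hReE : (A - A₀).map Complex.re = A.map Complex.re - C⁻¹ := by
    ext i j
    simp only [Matrix.map_apply, Matrix.sub_apply, Complex.sub_re, hA₀, Complex.coe_algebraMap, Complex.ofReal_re]
  have hE' : WRS κ d (A.map Complex.re - C⁻¹) θ := by rw [← hReE]; exact hE.map_re
  have hu : IsUnit (C⁻¹ : Matrix Λ Λ ℝ) := (Matrix.isUnit_iff_isUnit_det _).2 hC.inv.det_pos.ne'.isUnit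
  have hK' : WRS κ d (C⁻¹)⁻¹ K := by rw [Matrix.nonsing_inv_nonsing_inv C hCu]; exact hK
  have hlow := B13PerturbativeStep.norm_det_le_norm_det_add hw hu hK' hE' hKθ
  rw [add_sub_cancel, Real.norm_of_nonneg hA.det_pos.le, Real.norm_of_nonneg hC.inv.det_pos.le] at hlow
  -- combine
  have hd : 0 < (A.map Complex.re).det := hA.det_pos
  have hratio : ‖A.det‖ / (A.map Complex.re).det
      ≤ Real.exp (Fintype.card Λ * (K * θ)) * Real.exp (Fintype.card Λ * (K * θ * (1 - K * θ)⁻¹)) := by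
    rw [div_le_iff₀ hd]
    calc ‖A.det‖ ≤ C⁻¹.det * Real.exp (Fintype.card Λ * (K * θ)) := hup
      _ ≤ (A.map Complex.re).det * Real.exp (Fintype.card Λ * (K * θ * (1 - K * θ)⁻¹))
            * Real.exp (Fintype.card Λ * (K * θ)) := mul_le_mul_of_nonneg_right hlow (Real.exp_pos _).le
      _ = Real.exp (Fintype.card Λ * (K * θ)) * Real.exp (Fintype.card Λ * (K * θ * (1 - K * θ)⁻¹))
            * (A.map Complex.re).det := by ring
  calc Real.sqrt (‖A.det‖ / (A.map Complex.re).det)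
      ≤ Real.sqrt (Real.exp (Fintype.card Λ * (K * θ))
          * Real.exp (Fintype.card Λ * (K * θ * (1 - K * θ)⁻¹))) := Real.sqrt_le_sqrt hratio
    _ = Real.exp (K * θ * (1 + (1 - K * θ)⁻¹) / 2 * Fintype.card Λ) := by
        rw [← Real.exp_add, ← Real.exp_half]
        congr 1
        ring

end From216

/-! ## §7 (v1.1, append-only). The integrability side conditions of (2.15) discharged: `hg215`, `hX215` hold at the
Gaussian majorant `K e^{½a‖B‖²}` of the last line as soon as `Γ_k(Z₀,σ(Z))` is continuous in `X` (it is linear) -/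

section Integrability

open B13Term214 (cgaussMean integrand214 F214 Gamma214)

omit [DecidableEq Λ] in
/-- The Gaussian weight `e^{−½⟨B, MB⟩}` is a continuous function of the field. [cite: Balaban1988RG2Cluster, (2.15) p.15]
(elementary API for (2.15)) -/
theorem continuous_gaussWeight (M : Matrix Λ Λ ℝ) : Continuous (gaussWeight M) := by
  show Continuous fun x : Λ → ℝ => Real.exp (-(1 / 2 * (x ⬝ᵥ (M *ᵥ x))))
  fun_prop

omit [DecidableEq Λ] [DecidableEq N] in
/-- **`Γ_k(Z₀, σ(Z))` is continuous in the white noise `X`**: the printed operator `Γ_k(Z₀,σ(Z)) =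
C*Δ_k(σ(Z))CZ₀ᶜ(C^{(k)})^{1/2}(σ(Z))` is LINEAR in `X` (`B13Term214.Gamma214 M T X = M·(Z₀ᶜ-part of T X)`), hence
continuous — the hypothesis `Continuous Γσ` of this section holds for the object of record.
[cite: Balaban1988RG2Cluster, (2.14) p.15] (elementary API for (2.15)) -/
theorem continuous_Gamma214 {C₀ : Type} [Fintype C₀] (M : Matrix Λ C₀ ℂ) (T : Matrix (Λ ⊕ C₀) (Λ ⊕ C₀) ℂ) :
    Continuous (Gamma214 M T) := by
  show Continuous fun X : Λ ⊕ C₀ → ℝ => M *ᵥ fun c => (T *ᵥ fun b => (X b : ℂ)) (Sum.inr c)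
  fun_prop

variable {A : Matrix Λ Λ ℂ} {C : Matrix Λ Λ ℝ}

/-- **`hg215` discharged** (the `B`-majorant of (2.15) is integrable against the weight of `Re C^{(k)}(Z₀,σ(Z))⁻¹`):
for the Gaussian majorant `K e^{½a‖B‖²}` of the last line ((2.20) + (2.22)) and any complex source `J` (= `Γ_k(Z₀,σ(Z))X`),
`B ↦ e^{−½⟨B,(Re A)B⟩} · e^{−⟨B, Re J⟩} · K e^{½a‖B‖²}` is integrable as soon as `⟨B, R₂B⟩ ≤ ρ‖B‖²` (`R₂ = C⁻¹ − Re A`,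
(2.16)/(2.21)) and `C⁻¹ − (ρ + a)I ≻ 0` (here from `λ_k(C) ≤ c`, `(ρ + a)c < 1`): it is continuous and dominated by
`|K|·e^{−½⟨B,C⁻¹B⟩}e^{−⟨B,Re J⟩ + ½(ρ+a)‖B‖²}`, the integrable `B`-integrand of (2.23)
(`B13Integral223.integrable_weight_mul_integrand`). [cite: Balaban1988RG2Cluster, (2.15) p.15, (2.16)–(2.21) p.16, (2.23) p.17] -/
theorem integrable_hg215_gauss (hC : C.PosDef) {ρ a c : ℝ} (K : ℝ)
    (hR2 : ∀ B : Λ → ℝ, B ⬝ᵥ ((C⁻¹ - A.map Complex.re) *ᵥ B) ≤ ρ * (B ⬝ᵥ B))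
    (hc : ∀ k, hC.1.eigenvalues k ≤ c) (hαc : (ρ + a) * c < 1) (J : Λ → ℂ) :
    Integrable (fun B : Λ → ℝ => gaussWeight (A.map Complex.re) B *
      (Real.exp (-(B ⬝ᵥ fun i => (J i).re)) * (K * Real.exp (a / 2 * (B ⬝ᵥ B))))) := by
  have hα : (C⁻¹ - (ρ + a) • (1 : Matrix Λ Λ ℝ)).PosDef := posDef_inv_sub_smul hC hc hαc
  have hi := (integrable_weight_mul_integrand hC hα (fun i => (J i).re)).const_mul ‖K‖
  refine hi.mono' ?_ (Filter.Eventually.of_forall fun B => ?_)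
  · have hcont : Continuous fun B : Λ → ℝ => gaussWeight (A.map Complex.re) B *
        (Real.exp (-(B ⬝ᵥ fun i => (J i).re)) * (K * Real.exp (a / 2 * (B ⬝ᵥ B)))) :=
      (continuous_gaussWeight _).mul (by fun_prop)
    exact hcont.aestronglyMeasurable
  · rw [norm_mul, norm_mul, norm_mul, Real.norm_of_nonneg (B2Eq228Conditioning.gaussWeight_pos _ B).le,
      Real.norm_of_nonneg (Real.exp_pos _).le, Real.norm_of_nonneg (Real.exp_pos _).le]
    have h1 : gaussWeight (A.map Complex.re) B ≤ gaussWeight C⁻¹ B * Real.exp (ρ / 2 * (B ⬝ᵥ B)) := by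
      rw [gaussWeight, gaussWeight, ← Real.exp_add]
      refine Real.exp_le_exp.2 ?_
      have h := hR2 B
      rw [sub_mulVec, dotProduct_sub] at h
      linarith
    calc gaussWeight (A.map Complex.re) B
          * (Real.exp (-(B ⬝ᵥ fun i => (J i).re)) * (‖K‖ * Real.exp (a / 2 * (B ⬝ᵥ B))))
        ≤ gaussWeight C⁻¹ B * Real.exp (ρ / 2 * (B ⬝ᵥ B))
            * (Real.exp (-(B ⬝ᵥ fun i => (J i).re)) * (‖K‖ * Real.exp (a / 2 * (B ⬝ᵥ B)))) :=
          mul_le_mul_of_nonneg_right h1 (by positivity)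
      _ = ‖K‖ * (gaussWeight C⁻¹ B * Real.exp (-(B ⬝ᵥ fun i => (J i).re) + (ρ + a) / 2 * (B ⬝ᵥ B))) := by
          have e : Real.exp (-(B ⬝ᵥ fun i => (J i).re) + (ρ + a) / 2 * (B ⬝ᵥ B))
              = Real.exp (-(B ⬝ᵥ fun i => (J i).re))
                * (Real.exp (ρ / 2 * (B ⬝ᵥ B)) * Real.exp (a / 2 * (B ⬝ᵥ B))) := by
            rw [← Real.exp_add, ← Real.exp_add]; congr 1; ring
          rw [e]; ring

omit [DecidableEq Λ] [DecidableEq N] in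
/-- **A Gaussian mean depending on a parameter is (strongly) measurable in the parameter** when the integrand is
jointly continuous — the measurability half of `hX215` for the inner `B`-integral `∫dμ_{(Re A)⁻¹}(B) e^{−⟨B,Re Γ_σX⟩}ψ(B)`
as a function of `X` (Fubini measurability of a parametric Bochner integral, `MeasureTheory.StronglyMeasurable.
integral_prod_right`). [cite: Balaban1988RG2Cluster, (2.15) p.15] (elementary API for (2.15)) -/
theorem stronglyMeasurable_gaussMean_param (M : Matrix Λ Λ ℝ) {g : (N → ℝ) → (Λ → ℝ) → ℝ}
    (hg : Continuous (Function.uncurry g)) :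
    StronglyMeasurable fun X : N → ℝ => gaussMean M (g X) := by
  have hf : Continuous (Function.uncurry fun (X : N → ℝ) (B : Λ → ℝ) => gaussWeight M B • g X B) := by
    have h1 : Continuous fun p : (N → ℝ) × (Λ → ℝ) => gaussWeight M p.2 :=
      (continuous_gaussWeight M).comp continuous_snd
    exact h1.smul hg
  have hI := hf.stronglyMeasurable.integral_prod_right (ν := (volume : Measure (Λ → ℝ)))
  show StronglyMeasurable fun X : N → ℝ => (gaussNorm M)⁻¹ • ∫ B, gaussWeight M B • g X B
  exact hI.const_smul (gaussNorm M)⁻¹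

omit [DecidableEq Λ] in
/-- **The `X`-majorant of (2.15) is measurable** (the measurability half of `hX215`): for `Γ_σ` continuous in `X`, any
complex matrix `A'` (= `C^{(k)}(Z₀,σ(Z))`), any real constant `r` (= `|det A/det Re A|^{1/2}`) and the Gaussian majorant
`K e^{½a‖B‖²}` of the last line, `X ↦ e^{−½‖X‖²}·e^{−½Re⟨Γ_σX, A'Γ_σX⟩}·r·∫dμ_{M⁻¹}(B) e^{−⟨B,Re Γ_σX⟩}K e^{½a‖B‖²}` is
a.e.-strongly measurable (continuous factors and `stronglyMeasurable_gaussMean_param`).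
[cite: Balaban1988RG2Cluster, (2.15) p.15] (elementary API for (2.15)) -/
theorem aestronglyMeasurable_X215 (M : Matrix Λ Λ ℝ) {Γσ : (N → ℝ) → (Λ → ℂ)} (hΓc : Continuous Γσ)
    (A' : Matrix Λ Λ ℂ) (r K a : ℝ) :
    AEStronglyMeasurable (fun X : N → ℝ => gaussWeight (1 : Matrix N N ℝ) X *
      (Real.exp (-(1 / 2) * ((Γσ X) ⬝ᵥ (A' *ᵥ Γσ X)).re)
        * (r * gaussMean M (fun B => Real.exp (-(B ⬝ᵥ fun i => (Γσ X i).re))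
          * (K * Real.exp (a / 2 * (B ⬝ᵥ B))))))) := by
  have h1 : Continuous fun X : N → ℝ => gaussWeight (1 : Matrix N N ℝ) X := continuous_gaussWeight _
  have h2 : Continuous fun X : N → ℝ => Real.exp (-(1 / 2) * ((Γσ X) ⬝ᵥ (A' *ᵥ Γσ X)).re) := by fun_prop
  have h3 : StronglyMeasurable fun X : N → ℝ => gaussMean M (fun B => Real.exp (-(B ⬝ᵥ fun i => (Γσ X i).re))
      * (K * Real.exp (a / 2 * (B ⬝ᵥ B)))) := by
    refine stronglyMeasurable_gaussMean_param M ?_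
    show Continuous fun p : (N → ℝ) × (Λ → ℝ) =>
      Real.exp (-(p.2 ⬝ᵥ fun i => (Γσ p.1 i).re)) * (K * Real.exp (a / 2 * (p.2 ⬝ᵥ p.2)))
    fun_prop
  exact h1.aestronglyMeasurable.mul (h2.aestronglyMeasurable.mul
    ((stronglyMeasurable_const.mul h3).aestronglyMeasurable))

/-- **`hX215` discharged** (the `X`-majorant of (2.15) is `dμ₀`-integrable): under the replacement hypotheses of
`integrand215_replace_le` (`R₁`, (2.17) twice, `R₂`, `R₃`) and of `B13Integral223.integral223_le` at `α₅ = 2ρ + a`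
(`λ_k(C) ≤ c`, `α₅c ≤ ½`, `⟨Γ₀X,CΓ₀X⟩ ≤ g‖X‖²`, `α₅(1+2cg) < 1`), for `Γ_σ` continuous in `X` and the Gaussian majorant
`K e^{½a‖B‖²}` of the last line, the `X`-integrand of the right side of (2.15) —
`e^{−½Re⟨Γ_σX,A⁻¹Γ_σX⟩}·|det A/det Re A|^{1/2}·∫dμ_{(Re A)⁻¹}(B) e^{−⟨B,Re Γ_σX⟩}K e^{½a‖B‖²}` — is integrable against
`dμ₀(X)`: it is measurable (`aestronglyMeasurable_X215`) and dominated by `e^{2η|Λ|}·K·`[the integrand of (2.23)]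
(`integrand215_replace_le`), which is integrable (`integrable_integrand223`).
[cite: Balaban1988RG2Cluster, (2.15) p.15, (2.16)–(2.21) p.16, (2.23) p.17] -/
theorem integrable_hX215_gauss (hA : (A.map Complex.re).PosDef) (hC : C.PosDef) {Γσ : (N → ℝ) → (Λ → ℂ)}
    (hΓc : Continuous Γσ) (Γ₀ : Matrix Λ N ℝ) {ρ η a K c g : ℝ} (hρ0 : 0 ≤ ρ) (ha0 : 0 ≤ a) (hK : 0 ≤ K)
    (hR1 : ∀ X : N → ℝ, -(1 / 2) * ((Γσ X) ⬝ᵥ (A⁻¹ *ᵥ Γσ X)).re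
      ≤ -(1 / 2 * ((Γ₀ *ᵥ X) ⬝ᵥ (C *ᵥ (Γ₀ *ᵥ X)))) + ρ / 2 * (X ⬝ᵥ X))
    (h17a : Real.sqrt (‖A.det‖ / (A.map Complex.re).det) ≤ Real.exp (η * Fintype.card Λ))
    (h17b : Real.sqrt ((A.map Complex.re).det / C⁻¹.det) ≤ Real.exp (η * Fintype.card Λ))
    (hR2 : ∀ B : Λ → ℝ, B ⬝ᵥ ((C⁻¹ - A.map Complex.re) *ᵥ B) ≤ ρ * (B ⬝ᵥ B))
    (hR3 : ∀ (X : N → ℝ) (B : Λ → ℝ), -(B ⬝ᵥ fun i => (Γσ X i).re)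
      ≤ -(B ⬝ᵥ (Γ₀ *ᵥ X)) + ρ / 2 * (X ⬝ᵥ X + B ⬝ᵥ B))
    (hc0 : 0 ≤ c) (hc : ∀ k, hC.1.eigenvalues k ≤ c) (hαc : (2 * ρ + a) * c ≤ 1 / 2)
    (hΓ : ∀ X : N → ℝ, (Γ₀ *ᵥ X) ⬝ᵥ (C *ᵥ (Γ₀ *ᵥ X)) ≤ g * (X ⬝ᵥ X))
    (hsmall : (2 * ρ + a) * (1 + 2 * c * g) < 1) :
    Integrable (fun X : N → ℝ => gaussWeight (1 : Matrix N N ℝ) X *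
      (Real.exp (-(1 / 2) * ((Γσ X) ⬝ᵥ (A⁻¹ *ᵥ Γσ X)).re)
        * (Real.sqrt (‖A.det‖ / (A.map Complex.re).det)
          * gaussMean (A.map Complex.re) (fun B => Real.exp (-(B ⬝ᵥ fun i => (Γσ X i).re))
            * (K * Real.exp (a / 2 * (B ⬝ᵥ B))))))) := by
  have hα0 : 0 ≤ 2 * ρ + a := by linarith
  have hα : (C⁻¹ - (2 * ρ + a) • (1 : Matrix Λ Λ ℝ)).PosDef := posDef_inv_sub_smul hC hc (by linarith)
  have hi := (integrable_integrand223 hC Γ₀ hα0 hc0 hc hαc hΓ hsmall).const_mul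
    (Real.exp (2 * η * Fintype.card Λ) * K)
  refine hi.mono' (aestronglyMeasurable_X215 _ hΓc _ _ _ _) (Filter.Eventually.of_forall fun X => ?_)
  have hM0 : 0 ≤ gaussMean (A.map Complex.re) (fun B => Real.exp (-(B ⬝ᵥ fun i => (Γσ X i).re))
      * (K * Real.exp (a / 2 * (B ⬝ᵥ B)))) :=
    gaussMean_nonneg _ fun B => by positivity
  rw [Real.norm_of_nonneg (mul_nonneg (B2Eq228Conditioning.gaussWeight_pos _ X).le
    (mul_nonneg (Real.exp_pos _).le (mul_nonneg (Real.sqrt_nonneg _) hM0)))]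
  have hrep := integrand215_replace_le hA hC Γσ Γ₀ ha0 hK hR1 h17a h17b hR2 hR3
    (fun B => K * Real.exp (a / 2 * (B ⬝ᵥ B))) (fun B => by positivity) (fun B => le_rfl) hα X
  calc gaussWeight (1 : Matrix N N ℝ) X *
        (Real.exp (-(1 / 2) * ((Γσ X) ⬝ᵥ (A⁻¹ *ᵥ Γσ X)).re)
          * (Real.sqrt (‖A.det‖ / (A.map Complex.re).det)
            * gaussMean (A.map Complex.re) (fun B => Real.exp (-(B ⬝ᵥ fun i => (Γσ X i).re))
              * (K * Real.exp (a / 2 * (B ⬝ᵥ B))))))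
      ≤ gaussWeight (1 : Matrix N N ℝ) X * (Real.exp (2 * η * Fintype.card Λ) * K
          * (Real.exp (-(1 / 2 * ((Γ₀ *ᵥ X) ⬝ᵥ (C *ᵥ (Γ₀ *ᵥ X)))) + (2 * ρ + a) / 2 * (X ⬝ᵥ X))
            * innerB C (2 * ρ + a) (Γ₀ *ᵥ X))) :=
        mul_le_mul_of_nonneg_left hrep (B2Eq228Conditioning.gaussWeight_pos _ X).le
    _ = Real.exp (2 * η * Fintype.card Λ) * K * (gaussWeight (1 : Matrix N N ℝ) X *
          (Real.exp (-(1 / 2 * ((Γ₀ *ᵥ X) ⬝ᵥ (C *ᵥ (Γ₀ *ᵥ X)))) + (2 * ρ + a) / 2 * (X ⬝ᵥ X))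
            * innerB C (2 * ρ + a) (Γ₀ *ᵥ X))) := by ring

variable {C₀ : Type} [Fintype C₀] [DecidableEq C₀]

/-- **`|∫dμ₀(X)|_Z (lines 2–4 of (2.14))| ≤ e^{2η|Λ|}·K·`(2.23) with NO integrability side condition** — the theorem
`norm_core214_le_223` ((2.15) lines 2–4 → the perturbative replacement of pp. 15–17 → (2.23)) for the objects of record
`B13Term214.cgaussMean 1 (integrand214 A Γ_σ F)` with a last line `‖F‖ ≤ ψ ≤ K e^{½a‖B‖²}`, the hypotheses `hg215`,
`hX215` DISCHARGED: (2.15) is applied with the Gaussian majorant `K e^{½a‖B‖²}` itself (nothing measurable is asked of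
`F` or `ψ`), whose two integrability conditions are `integrable_hg215_gauss` and `integrable_hX215_gauss`; the one
remaining analytic input is the continuity of `X ↦ Γ_k(Z₀,σ(Z))X` (`continuous_Gamma214` for the printed, linear,
operator). [cite: Balaban1988RG2Cluster, (2.14)–(2.15) p.15, (2.16)–(2.21) p.16, (2.23) p.17] -/
theorem norm_core214_le_223_of_continuous (hAs : A.IsSymm) (hA : (A.map Complex.re).PosDef) (hC : C.PosDef)
    {Γσ : (Λ ⊕ C₀ → ℝ) → (Λ → ℂ)} (hΓc : Continuous Γσ) (Γ₀ : Matrix Λ (Λ ⊕ C₀) ℝ) (F : (Λ → ℝ) → ℂ)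
    (ψ : (Λ → ℝ) → ℝ) (hF : ∀ B, ‖F B‖ ≤ ψ B) {ρ η a K c g : ℝ} (hρ0 : 0 ≤ ρ) (ha0 : 0 ≤ a) (hK : 0 ≤ K)
    (hψ : ∀ B, ψ B ≤ K * Real.exp (a / 2 * (B ⬝ᵥ B)))
    (hR1 : ∀ X : Λ ⊕ C₀ → ℝ, -(1 / 2) * ((Γσ X) ⬝ᵥ (A⁻¹ *ᵥ Γσ X)).re
      ≤ -(1 / 2 * ((Γ₀ *ᵥ X) ⬝ᵥ (C *ᵥ (Γ₀ *ᵥ X)))) + ρ / 2 * (X ⬝ᵥ X))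
    (h17a : Real.sqrt (‖A.det‖ / (A.map Complex.re).det) ≤ Real.exp (η * Fintype.card Λ))
    (h17b : Real.sqrt ((A.map Complex.re).det / C⁻¹.det) ≤ Real.exp (η * Fintype.card Λ))
    (hR2 : ∀ B : Λ → ℝ, B ⬝ᵥ ((C⁻¹ - A.map Complex.re) *ᵥ B) ≤ ρ * (B ⬝ᵥ B))
    (hR3 : ∀ (X : Λ ⊕ C₀ → ℝ) (B : Λ → ℝ), -(B ⬝ᵥ fun i => (Γσ X i).re)
      ≤ -(B ⬝ᵥ (Γ₀ *ᵥ X)) + ρ / 2 * (X ⬝ᵥ X + B ⬝ᵥ B))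
    (hc0 : 0 ≤ c) (hc : ∀ k, hC.1.eigenvalues k ≤ c) (hαc : (2 * ρ + a) * c ≤ 1 / 2)
    (hΓ : ∀ X : Λ ⊕ C₀ → ℝ, (Γ₀ *ᵥ X) ⬝ᵥ (C *ᵥ (Γ₀ *ᵥ X)) ≤ g * (X ⬝ᵥ X))
    (hsmall : (2 * ρ + a) * (1 + 2 * c * g) < 1) :
    ‖cgaussMean (1 : Matrix (Λ ⊕ C₀) (Λ ⊕ C₀) ℂ) (fun X => integrand214 A Γσ F X)‖
      ≤ Real.exp (2 * η * Fintype.card Λ) * K * integral223 C Γ₀ (2 * ρ + a) := by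
  have hαc' : (ρ + a) * c < 1 := by nlinarith
  exact norm_core214_le_223 hAs hA hC Γσ Γ₀ F (fun B => K * Real.exp (a / 2 * (B ⬝ᵥ B)))
    (fun B => (hF B).trans (hψ B)) hρ0 ha0 hK (fun B => le_rfl) hR1 h17a h17b hR2 hR3 hc0 hc hαc hΓ hsmall
    (fun X => integrable_hg215_gauss hC K hR2 hc hαc' (Γσ X))
    (integrable_hX215_gauss hA hC hΓc Γ₀ hρ0 ha0 hK hR1 h17a h17b hR2 hR3 hc0 hc hαc hΓ hsmall)

/-- **… and then `≤ e^{2η|Λ|}·K·e^{α₅c|Λ|}·e^{α₅(1+2cg)|N|}`** — the (2.26) factor `exp O(1)α₅|Z|` for the objects of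
record, `B13Integral223.integral223_le` inserted (`α₅ = 2ρ + a`, `α₅(1+2cg) ≤ ½`); no integrability side condition.
[cite: Balaban1988RG2Cluster, (2.14)–(2.15) p.15, (2.23)–(2.26) p.17] -/
theorem norm_core214_le_226_of_continuous (hAs : A.IsSymm) (hA : (A.map Complex.re).PosDef) (hC : C.PosDef)
    {Γσ : (Λ ⊕ C₀ → ℝ) → (Λ → ℂ)} (hΓc : Continuous Γσ) (Γ₀ : Matrix Λ (Λ ⊕ C₀) ℝ) (F : (Λ → ℝ) → ℂ)
    (ψ : (Λ → ℝ) → ℝ) (hF : ∀ B, ‖F B‖ ≤ ψ B) {ρ η a K c g : ℝ} (hρ0 : 0 ≤ ρ) (ha0 : 0 ≤ a) (hK : 0 ≤ K)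
    (hψ : ∀ B, ψ B ≤ K * Real.exp (a / 2 * (B ⬝ᵥ B)))
    (hR1 : ∀ X : Λ ⊕ C₀ → ℝ, -(1 / 2) * ((Γσ X) ⬝ᵥ (A⁻¹ *ᵥ Γσ X)).re
      ≤ -(1 / 2 * ((Γ₀ *ᵥ X) ⬝ᵥ (C *ᵥ (Γ₀ *ᵥ X)))) + ρ / 2 * (X ⬝ᵥ X))
    (h17a : Real.sqrt (‖A.det‖ / (A.map Complex.re).det) ≤ Real.exp (η * Fintype.card Λ))
    (h17b : Real.sqrt ((A.map Complex.re).det / C⁻¹.det) ≤ Real.exp (η * Fintype.card Λ))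
    (hR2 : ∀ B : Λ → ℝ, B ⬝ᵥ ((C⁻¹ - A.map Complex.re) *ᵥ B) ≤ ρ * (B ⬝ᵥ B))
    (hR3 : ∀ (X : Λ ⊕ C₀ → ℝ) (B : Λ → ℝ), -(B ⬝ᵥ fun i => (Γσ X i).re)
      ≤ -(B ⬝ᵥ (Γ₀ *ᵥ X)) + ρ / 2 * (X ⬝ᵥ X + B ⬝ᵥ B))
    (hc0 : 0 ≤ c) (hc : ∀ k, hC.1.eigenvalues k ≤ c) (hαc : (2 * ρ + a) * c ≤ 1 / 2) (hg : 0 ≤ g)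
    (hΓ : ∀ X : Λ ⊕ C₀ → ℝ, (Γ₀ *ᵥ X) ⬝ᵥ (C *ᵥ (Γ₀ *ᵥ X)) ≤ g * (X ⬝ᵥ X))
    (hsmall : (2 * ρ + a) * (1 + 2 * c * g) ≤ 1 / 2) :
    ‖cgaussMean (1 : Matrix (Λ ⊕ C₀) (Λ ⊕ C₀) ℂ) (fun X => integrand214 A Γσ F X)‖
      ≤ Real.exp (2 * η * Fintype.card Λ) * K
        * (Real.exp ((2 * ρ + a) * c * Fintype.card Λ)
          * Real.exp ((2 * ρ + a) * (1 + 2 * c * g) * Fintype.card (Λ ⊕ C₀))) :=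
  (norm_core214_le_223_of_continuous hAs hA hC hΓc Γ₀ F ψ hF hρ0 ha0 hK hψ hR1 h17a h17b hR2 hR3 hc0 hc hαc hΓ
      (by linarith)).trans
    (mul_le_mul_of_nonneg_left (integral223_le hC Γ₀ (by linarith) hc0 hc hαc hg hΓ hsmall)
      (mul_nonneg (Real.exp_pos _).le hK))

/-- **(2.14) ⇒ (2.26) without the Cauchy prefactors, for the printed last line, with NO integrability side condition**:
the theorem `norm_core214_F214_le_223` for `F = (−1)^{|P|}χ_{k,Y₀}χᶜ_{k,P}exp[Στ(Y)𝐕_k(Y,·)]` (`B13Term214.F214`) under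
(2.22) + (2.20) and the replacement hypotheses, `hg215`/`hX215` discharged (Gaussian majorant; `Γ_σ` continuous in `X`):
`|∫dμ₀(X)|_Z (lines 2–4 of (2.14))| ≤ e^{2η|Λ|}·exp(−½γ₂(ε₁²/g_k²)|P| + w)·(2.23)` at `α₅ = 2ρ + γ₂ + a`.
[cite: Balaban1988RG2Cluster, (2.14)–(2.15) p.15, (2.20)–(2.22) p.16, (2.23)–(2.26) p.17] -/
theorem norm_core214_F214_le_223_of_continuous {D : Type*} (hAs : A.IsSymm) (hA : (A.map Complex.re).PosDef)
    (hC : C.PosDef) {Γσ : (Λ ⊕ C₀ → ℝ) → (Λ → ℂ)} (hΓc : Continuous Γσ) (Γ₀ : Matrix Λ (Λ ⊕ C₀) ℝ) (cardP : ℕ)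
    (χY₀ χcP : (Λ → ℝ) → ℝ) (hχ0 : ∀ B, 0 ≤ χY₀ B) (hχc0 : ∀ B, 0 ≤ χcP B) (Dfam : Finset D)
    (V : D → (Λ → ℝ) → ℂ) (τ : D → ℂ) {γ₂ r a w : ℝ} (qP : (Λ → ℝ) → ℝ)
    (h222 : ∀ B, χY₀ B * χcP B ≤ Real.exp (-(γ₂ / 2 * r ^ 2 * cardP) + γ₂ / 2 * qP B)) (hγ₂ : 0 ≤ γ₂)
    (hqP : ∀ B, qP B ≤ B ⬝ᵥ B) (h220 : ∀ B, ∑ Y ∈ Dfam, ‖τ Y‖ * ‖V Y B‖ ≤ a / 2 * (B ⬝ᵥ B) + w)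
    {ρ η c g : ℝ} (hρ0 : 0 ≤ ρ) (ha0 : 0 ≤ a)
    (hR1 : ∀ X : Λ ⊕ C₀ → ℝ, -(1 / 2) * ((Γσ X) ⬝ᵥ (A⁻¹ *ᵥ Γσ X)).re
      ≤ -(1 / 2 * ((Γ₀ *ᵥ X) ⬝ᵥ (C *ᵥ (Γ₀ *ᵥ X)))) + ρ / 2 * (X ⬝ᵥ X))
    (h17a : Real.sqrt (‖A.det‖ / (A.map Complex.re).det) ≤ Real.exp (η * Fintype.card Λ))
    (h17b : Real.sqrt ((A.map Complex.re).det / C⁻¹.det) ≤ Real.exp (η * Fintype.card Λ))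
    (hR2 : ∀ B : Λ → ℝ, B ⬝ᵥ ((C⁻¹ - A.map Complex.re) *ᵥ B) ≤ ρ * (B ⬝ᵥ B))
    (hR3 : ∀ (X : Λ ⊕ C₀ → ℝ) (B : Λ → ℝ), -(B ⬝ᵥ fun i => (Γσ X i).re)
      ≤ -(B ⬝ᵥ (Γ₀ *ᵥ X)) + ρ / 2 * (X ⬝ᵥ X + B ⬝ᵥ B))
    (hc0 : 0 ≤ c) (hc : ∀ k, hC.1.eigenvalues k ≤ c) (hαc : (2 * ρ + (γ₂ + a)) * c ≤ 1 / 2)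
    (hΓ : ∀ X : Λ ⊕ C₀ → ℝ, (Γ₀ *ᵥ X) ⬝ᵥ (C *ᵥ (Γ₀ *ᵥ X)) ≤ g * (X ⬝ᵥ X))
    (hsmall : (2 * ρ + (γ₂ + a)) * (1 + 2 * c * g) < 1) :
    ‖cgaussMean (1 : Matrix (Λ ⊕ C₀) (Λ ⊕ C₀) ℂ) (fun X => integrand214 A Γσ (F214 cardP χY₀ χcP Dfam V τ) X)‖
      ≤ Real.exp (2 * η * Fintype.card Λ) * Real.exp (-(γ₂ / 2 * r ^ 2 * cardP) + w)
        * integral223 C Γ₀ (2 * ρ + (γ₂ + a)) :=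
  norm_core214_le_223_of_continuous hAs hA hC hΓc Γ₀ _ _
    (fun B => B13FirstEstimate215.norm_F214_le_printed cardP χY₀ χcP Dfam V τ B (hχ0 B) (hχc0 B)) hρ0
    (by linarith) (Real.exp_pos _).le
    (fun B => majorant_F214_le cardP χY₀ χcP Dfam V τ qP B (h222 B) hγ₂ (hqP B) (h220 B))
    hR1 h17a h17b hR2 hR3 hc0 hc hαc hΓ hsmall

end Integrability

end Literature.MathematicalPhysics.QuantumFieldTheory.Balaban1983to89.B13Replacement223

end
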